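import Literature.Probability.RandomPlanarGeometry.HexSAWStripSurfaceThresholdUnique
import Literature.Probability.RandomPlanarGeometry.HexSAWStripSurfaceWidthOneThreshold
import HarnessLib

/-!
# The lower LINEAR law at the strip threshold: `B_{T,N}(x_c; y_T) ≥ c_T (N+1) − C_T` for every width `T`, by a linear
# chain-to-bridge comparison (BBdGDCG 2014, Corollary 8 — the divergence at the radius, quantified without rationality)

Topic `Literature/Probability/RandomPlanarGeometry` (continues `HexSAWStripSurfaceThresholdRate.lean` — `HV.stripNu_stripYT : ν_T(y_T) = x_c⁻¹`,
Fekete's floor `HV.succ_le_mul_sum_pow_mul_stripZL : N + 1 ≤ max(1,y⁻¹) Σ_{n ≤ N} x_cⁿ Z_{T,n}(y)` at the critical rate, the strict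
monotonicity of the thresholds `HV.stripYT_succ_lt : y_{T+1} < y_T`, the √-law `HV.exists_sqrt_le_stripGFy_beta_stripYT` —,
`HexSAWStripSurfaceThresholdUnique.lean` (`HV.stripNu_lt_inv_iff`), `HexSAWStripSurfaceGrowth.lean` (`HV.stripChains`, `HV.stripZL`,
`HV.xstd`, the split lemmas `HV.splFst_mem` / `HV.splSnd_mem`), `HexSAWLowerBound.lean` (`HV.bridgeLists`, the inner lists of the walks
`a → β` of `S_{T,L}`) and `HexSAWStripSurfaceWidthOneThreshold.lean` (`T = 1`: `B_{1,L}(x_c; y_1) = 2(L+1)`)).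
Source: N. R. Beaton, M. Bousquet-Mélou, J. de Gier, H. Duminil-Copin, A. J. Guttmann, *The critical fugacity for surface adsorption of
self-avoiding walks on the honeycomb lattice is `1 + √2`*, Comm. Math. Phys. 326 (2014) 727–754, arXiv:1109.0358v5, §3.2 Corollary 8
(p. 12): "There exists a unique `y_T > 0` such that `ρ_T(y_T) = x_c := 1/μ`. The series (in `y`) `A_T(x_c, y)`, `B_T(x_c, y)` and `C_T(x_c, y)`
have radius of convergence `y_T`", with the rationality of the proof of Proposition 7 (p. 12: "a rational function of `x` and `y`") and the
strict monotonicity of its proof (p. 13: "`y_{T+1} < y_T`"); H. Duminil-Copin, S. Smirnov, Ann. Math. 175 (2012) §3 (the strip `S_{T,L}`, its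
walks `a → β`, and the unfolding bound "`Z(x) ≤ … ∏ (1 + B_T^x)²`").  In print the divergence of `B_T(x_c; ·)` at `y_T` is that of a pole of a
rational function; NO rate in the strip length `L` is printed.

## What is proved (namespace `Literature.Probability.RandomPlanarGeometry.SAW.HV`; plumbing in `HV.LinLow`; `x_c = hexCriticalFugacity`)

* ★★ `sum_pow_mul_stripZL_le_linear` — for `T ≥ 2` there are `K₁`, `K₂ > 0` with
  `Σ_{n ≤ N} x_cⁿ Z_{T,n}(y) ≤ K₁ + K₂ · B_{T,N}(x_c; y)` for all `N` and all `1 ≤ y ≤ y_T`: the chains of the strip are bounded by its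
  `β`-walks LINEARLY (the tree's `HV.sum_pow_mul_stripZL_le_at`, the Duminil-Copin–Smirnov cut of a chain into two weak bridges, is
  quadratic in the bridge bound).
* ★★★ `exists_linear_le_stripGFy_beta_stripYT` — for every `T ≥ 1`: `∃ c > 0, ∃ C, ∀ N, c · (N + 1) − C ≤ B_{T,N}(x_c; y_T)` — THE LOWER
  LINEAR LAW at the threshold (the tree had `c √(N+1) − C`); `eventually_linear_le_stripGFy_beta_stripYT` (`c · N ≤ B_{T,N}` for large `N`);
  `exists_linear_le_stripGFy_beta_stripYT_of_two_le` (the `T ≥ 2` case by the route below; `T = 1` is the exact `2(N+1)`).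
* ★★ `exists_linear_le_stripGFy_alpha_stripYT` — the same rate for the arches, `c' (N+1) − C' ≤ A_{T,N+1}(x_c; y_T)` (identity (16) at `y_T > y*`
  and `E_{T,N} ≤ x_c^{1−2T} A_{T,N+1}`, as in the tree's √ version).
* `succ_le_yK_mul_linear_stripGFy_beta_stripYT` — Fekete's floor composed with the comparison (`T ≥ 2`).
* ★★★ `partialSum_stripBcoeff_stripYT_ge_linear` — the COEFFICIENT form, every `T ≥ 1`: `∃ s > 0, ∃ C, ∀ M, s·M − C ≤ Σ_{m ≤ M} β_{T,m} y_T^m`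
  (`β_{T,m} = HV.stripBcoeff T m`), from the box law through `B_{T,L}(x_c; y_T) ≤ Σ_{m ≤ |V(S_{T,L})|} β_{T,m} y_T^m`
  (`LinLow.stripGFy_beta_le_partialSum_card`) and `|V(S_{T,L})| ≤ 4(T+1)L + 2(T+1)²` (`LinLow.card_stripV_le_affine`) — the lane's (R2)
  lower law for every width with NO boundedness / first-order / rationality hypothesis.
* Plumbing (`LinLow`): `chainsUpTo`, `cwt`, the bottom-avoiding class `botAvoidN` / `botAvoidSum` and ★ its FINITENESS
  `exists_botAvoidSum_le` (`T ≥ 2`, `1 ≤ y < y_{T−1}`: the vertices `1 … |l|−3` of a bottom-avoiding chain lie on levels `≥ 2` —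
  `two_le_lev_getElem` — i.e. in the strip of width `T − 1` after a shift, `bM_mem_stripChains`; three-piece split `bSplit`, `bSplit_injOn`);
  the indices `jB` (first bottom vertex) / `iT` (last top vertex), the direct case `CaseD` and its split `dSplit = (dA, dM, dC)` into a
  bottom-avoiding prefix, ONE `β`-walk of `S_{T,N}` (`dM_mem`) and a top-free suffix, with exact weights `cwt_eq_dWt` and injectivity
  `dSplit_injOn`, hence `sum_caseD_le`; the time reversal `revStd` (`revStd_injOn`, `caseD_revStd`, `sum_caseR_le`); the assembly
  `sum_pow_mul_stripZL_le_aux`.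

## Route (lane «pcv-sawmu», a-p2 g17; automaton-free, rationality-free, independent of the lane's first-order bound (P))

A chain `l` of `S_T` (standard head) with a bottom vertex before some top vertex is cut at its FIRST bottom vertex `j` and its LAST top
vertex `i > j`: `l[0..j]` avoids the bottom wall except at its end, `l[j..i]` moved to the origin is a walk `a → β` of `S_{T,N}` (`N ≥`
the number of steps: every vertex is within `N` columns of `l[j]`), and `l[i..]` has no top vertex after its head.  Every top vertex of
`l` is in the first two pieces, so the weight `x_c^{|l|−1} y^{#top}` is the product of the three weights (the suffix unweighted in `y`),
and the map is injective.  If instead every top vertex precedes every bottom vertex, the time-reversed chain is of the first kind.  Chains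
without top vertices weigh `x_cⁿ`; chains without bottom vertices are bottom-avoiding.  The bottom-avoiding pieces have bounded total
weight for `y ≤ y_T` because (a level-one vertex having a single neighbour off the bottom) their interior lives one level pair up, in the
strip of width `T − 1`, whose series converges for `y < y_{T−1}`, and `y_T < y_{T−1}`; the top-free pieces are bounded by the strip series
at `y = 1 < y_T`.  Hence `Σ_{n ≤ N} x_cⁿ Z_{T,n}(y) ≤ S + 𝔅 + 2 𝔅 x_c⁻¹ S · B_{T,N}(x_c; y)`, and at `y = y_T` Fekete's floor
`N + 1 ≤ max(1, y_T⁻¹) Σ_{n ≤ N} x_cⁿ Z_{T,n}(y_T)` gives the law.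

HOME prior art named (lane bookkeeping, none in the tree): a-p2 g15's «LINLAW» (`HexSAWStripSurfaceLinearLawOfRational`, the box law
CONDITIONAL on the printed rationality `StripBridgeSeriesRational T`, filing queued) and «COEFF-TRANSFER» (the equivalence of the box and
coefficient forms); a-idea-1 g27/g28's cars 29 «THRESHOLD-BOOTSTRAP» / 32 «THRESHOLD-LAW» / 35 «LINEAR-LAW» with a-p2 g16's «BRIDGE-RENEWAL»
(the coefficient law `c·M ≤ Σ_{m ≤ M} β_{T,m} y_T^m ≤ C(M+1)` through the boundedness of `β_{T,m} y_T^m` / the first-order bound (P), filing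
queued).  The present file is the direct, unconditional route to the `L`-law; with the lane's linear UPPER law
`B_{T,L}(x_c; y_T) ≤ C(L+1)` («BRIDGE-RENEWAL») it gives `B_{T,L}(x_c; y_T) ≍ L` for every width.  Label: NEW-IN-WRITING (modest): a
quantitative lower rate, linear in the strip length, of the divergence at the radius of Corollary 8, for every width, without the transfer
matrix; and the linear chain-to-bridge comparison inside one strip.  NOT claimed: the upper law (banked elsewhere), the pole order /
rationality, anything uniform in `T`, the values of the constants.
-/

noncomputable section

open Finset Filter Topology Literature.Probability.LatticeModels Literature.Probability.Percolation

namespace Literature.Probability.RandomPlanarGeometry.SAW.HV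

namespace LinLow

variable {T : ℕ}

/-! ### §1 Chains with at most `N` steps and their weight -/

/-- The self-avoiding lists of `S_T` with standard head and at most `N` steps. [cite: MadrasSlade1993, §8.2, eq. (8.2.1); lane plumbing] -/
def chainsUpTo (T N : ℕ) : Finset (List HV) := (range (N + 1)).biUnion fun n => stripChains T n

/-- The weight `x_c^{|l| − 1} y^{#top(l)}` of a vertex list (`|l| − 1` steps). [cite: BeatonBousquetMelouDeGierDuminilCopinGuttmann2014, §3.2 (arXiv v5 p. 10: c_{T,k}(y,z))] -/
def cwt (T : ℕ) (y : ℝ) (l : List HV) : ℝ := hexCriticalFugacity ^ (l.length - 1) * y ^ topCnt T l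

/-- `cwt ≥ 0` for `y ≥ 0`. [cite: BeatonBousquetMelouDeGierDuminilCopinGuttmann2014, §3.2] -/
theorem cwt_nonneg (T : ℕ) {y : ℝ} (hy : 0 ≤ y) (l : List HV) : 0 ≤ cwt T y l :=
  mul_nonneg (pow_nonneg hexCriticalFugacity_pos_lt_one.1.le _) (pow_nonneg hy _)

/-- `cwt` is monotone in `y ≥ 0`. [cite: BeatonBousquetMelouDeGierDuminilCopinGuttmann2014, Proposition 6 (monotone in y)] -/
theorem cwt_mono (T : ℕ) {y y' : ℝ} (hy : 0 ≤ y) (hyy' : y ≤ y') (l : List HV) : cwt T y l ≤ cwt T y' l :=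
  mul_le_mul_of_nonneg_left (pow_le_pow_left₀ hy hyy' _) (pow_nonneg hexCriticalFugacity_pos_lt_one.1.le _)


/-- Sums of products of three factors over a triple product of finsets. [cite: BeatonBousquetMelouDeGierDuminilCopinGuttmann2014, §3.2 (products of strip partition functions); lane plumbing (Finset algebra)] -/
theorem sum_triple_product {α β γ : Type*} (A : Finset α) (B : Finset β) (C : Finset γ) (f : α → ℝ) (g : β → ℝ) (h : γ → ℝ) :
    ∑ t ∈ A ×ˢ (B ×ˢ C), f t.1 * (g t.2.1 * h t.2.2) = (∑ a ∈ A, f a) * ((∑ b ∈ B, g b) * ∑ c ∈ C, h c) := by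
  rw [sum_product, sum_mul_sum, sum_mul_sum]
  refine sum_congr rfl fun a _ => ?_
  rw [sum_product]
  refine sum_congr rfl fun b _ => ?_
  rw [mul_sum]

/-- The chain finsets of different lengths are disjoint. [cite: MadrasSlade1993, §8.2; lane plumbing] -/
theorem disj_stripChains (T : ℕ) (s : Finset ℕ) : Set.PairwiseDisjoint (s : Set ℕ) (stripChains T) := by
  intro i _ j _ hij
  rw [Function.onFun, Finset.disjoint_left]
  intro l hi hj
  have h1 := (mem_stripChains_iff.1 hi).2.2.1
  have h2 := (mem_stripChains_iff.1 hj).2.2.1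
  omega

/-- Membership in `chainsUpTo`. [cite: MadrasSlade1993, §8.2; lane plumbing] -/
theorem mem_chainsUpTo_iff {T N : ℕ} {l : List HV} : l ∈ chainsUpTo T N ↔ ∃ n, n ≤ N ∧ l ∈ stripChains T n := by
  simp [chainsUpTo]

/-- A chain of `S_T` with `n ≤ N` steps lies in `chainsUpTo T N`. [cite: MadrasSlade1993, §8.2; lane plumbing] -/
theorem mem_chainsUpTo_of_mem {T N n : ℕ} {l : List HV} (hl : l ∈ stripChains T n) (hn : n ≤ N) : l ∈ chainsUpTo T N :=
  mem_chainsUpTo_iff.2 ⟨n, hn, hl⟩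

/-- `chainsUpTo` increases with `N`. [cite: MadrasSlade1993, §8.2; lane plumbing] -/
theorem chainsUpTo_mono {T N N' : ℕ} (h : N ≤ N') : chainsUpTo T N ⊆ chainsUpTo T N' := fun l hl => by
  obtain ⟨n, hn, hl⟩ := mem_chainsUpTo_iff.1 hl
  exact mem_chainsUpTo_of_mem hl (hn.trans h)

/-- `Σ_{l ∈ chainsUpTo T N} cwt(l) = Σ_{n ≤ N} x_c^n Z_{T,n}(y)`. [cite: BeatonBousquetMelouDeGierDuminilCopinGuttmann2014, §3.2 (c_{T,k})] -/
theorem sum_cwt_chainsUpTo (T N : ℕ) (y : ℝ) :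
    ∑ l ∈ chainsUpTo T N, cwt T y l = ∑ n ∈ range (N + 1), hexCriticalFugacity ^ n * stripZL T n y := by
  rw [chainsUpTo, sum_biUnion (disj_stripChains T _)]
  refine sum_congr rfl fun n _ => ?_
  rw [stripZL, mul_sum]
  refine sum_congr rfl fun l hl => ?_
  rw [cwt, (mem_stripChains_iff.1 hl).2.2.1, Nat.add_sub_cancel]

/-- **Bounded partial sums below the threshold**: for `0 < y < y_T` there is `S ≥ 0` with `Σ_{n ≤ N} x_c^n Z_{T,n}(y) ≤ S` for all `N`.
[cite: BeatonBousquetMelouDeGierDuminilCopinGuttmann2014, Corollary 8, proof (arXiv v5 p. 13: "the series C_T(x_c,y) converges if x_c < ρ_T(y)")] -/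
theorem exists_partialSum_le (hT : 1 ≤ T) {y : ℝ} (hy : 0 < y) (hyT : y < stripYT T) :
    ∃ S : ℝ, 0 ≤ S ∧ ∀ N, ∑ n ∈ range (N + 1), hexCriticalFugacity ^ n * stripZL T n y ≤ S := by
  have hx := hexCriticalFugacity_pos_lt_one.1
  have hs := (summable_pow_mul_stripZL_iff_lt_stripYT hT hy).2 hyT
  have h0 : ∀ n, 0 ≤ hexCriticalFugacity ^ (n + 1) * stripZL T n y := fun n =>
    mul_nonneg (pow_nonneg hx.le _) (stripZL_nonneg T n hy.le)
  refine ⟨hexCriticalFugacity⁻¹ * ∑' n, hexCriticalFugacity ^ (n + 1) * stripZL T n y,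
    mul_nonneg (inv_nonneg.2 hx.le) (tsum_nonneg h0), fun N => ?_⟩
  have h1 : ∑ n ∈ range (N + 1), hexCriticalFugacity ^ n * stripZL T n y =
      hexCriticalFugacity⁻¹ * ∑ n ∈ range (N + 1), hexCriticalFugacity ^ (n + 1) * stripZL T n y := by
    rw [mul_sum]
    refine sum_congr rfl fun n _ => ?_
    rw [pow_succ]; field_simp
  rw [h1]
  exact mul_le_mul_of_nonneg_left (hs.sum_le_tsum _ fun n _ => h0 n) (inv_nonneg.2 hx.le)

/-- The total `x_c`-weight of the chains is bounded: `Σ_{l ∈ chainsUpTo T N} x_c^{|l|−1} ≤ S₁` uniformly in `N` (the strip series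
converges at `y = 1 < y_T`). [cite: BeatonBousquetMelouDeGierDuminilCopinGuttmann2014, Corollary 8 (arXiv v5 p. 12: radius y_T) and (17) (y* ≤ y_T, so 1 < y_T)] -/
theorem exists_sum_pow_length_le (hT : 1 ≤ T) :
    ∃ S : ℝ, 0 ≤ S ∧ ∀ N, ∑ l ∈ chainsUpTo T N, hexCriticalFugacity ^ (l.length - 1) ≤ S := by
  obtain ⟨S, hS0, hS⟩ := exists_partialSum_le hT one_pos (one_lt_stripYT hT)
  refine ⟨S, hS0, fun N => ?_⟩
  have h := sum_cwt_chainsUpTo T N 1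
  simp only [cwt, one_pow, mul_one] at h
  rw [h]
  exact hS N

/-! ### §2 The bottom-avoiding class and its finiteness (a walk off the bottom wall lives in width `T − 1`) -/

/-- **The bottom-avoiding chains**: chains of `S_T` (standard head, at most `N` steps) whose vertices except possibly the LAST avoid the
bottom level `0`. [cite: BeatonBousquetMelouDeGierDuminilCopinGuttmann2014, §3.2 (walks in a strip and their contacts with its two walls); lane] -/
def botAvoidN (T N : ℕ) : Finset (List HV) := (chainsUpTo T N).filter fun l => ∀ v ∈ l.dropLast, lev v ≠ 0

/-- The weighted sum `𝔅_{T,N}(y) := Σ_{l ∈ botAvoidN T N} x_c^{|l|−1} y^{#top(l)}`. [cite: BeatonBousquetMelouDeGierDuminilCopinGuttmann2014, §3.2; lane] -/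
def botAvoidSum (T N : ℕ) (y : ℝ) : ℝ := ∑ l ∈ botAvoidN T N, cwt T y l

/-- `𝔅_{T,N}(y) ≥ 0`. [cite: BeatonBousquetMelouDeGierDuminilCopinGuttmann2014, §3.2; lane] -/
theorem botAvoidSum_nonneg (T N : ℕ) {y : ℝ} (hy : 0 ≤ y) : 0 ≤ botAvoidSum T N y :=
  sum_nonneg fun l _ => cwt_nonneg T hy l

/-- `𝔅_{T,N}(y)` is monotone in `y ≥ 0`. [cite: BeatonBousquetMelouDeGierDuminilCopinGuttmann2014, Proposition 6 (monotone in y); lane] -/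
theorem botAvoidSum_mono_y (T N : ℕ) {y y' : ℝ} (hy : 0 ≤ y) (hyy' : y ≤ y') : botAvoidSum T N y ≤ botAvoidSum T N y' :=
  sum_le_sum fun l _ => cwt_mono T hy hyy' l

/-- `𝔅_{T,N}(y)` is monotone in `N` (`y ≥ 0`). [cite: BeatonBousquetMelouDeGierDuminilCopinGuttmann2014, §3.2; lane] -/
theorem botAvoidSum_mono_N (T : ℕ) {N N' : ℕ} (h : N ≤ N') {y : ℝ} (hy : 0 ≤ y) : botAvoidSum T N y ≤ botAvoidSum T N' y :=
  sum_le_sum_of_subset_of_nonneg (filter_subset_filter _ (chainsUpTo_mono h)) fun l _ _ => cwt_nonneg T hy l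

/-- A level-one vertex has exactly one neighbour off the bottom level: the vertex above it.
[cite: DuminilCopinSmirnov2012, §3 (vertices of type 1 have one edge up)] -/
theorem eq_up_of_lev_one {v w : HV} (hv : lev v = 1) (h : hvGraph.Adj v w) (hw : lev w ≠ 0) : w = (v.1, 1, false) := by
  obtain ⟨a, b, c⟩ := v
  obtain ⟨a', b', c'⟩ := w
  cases c <;> cases c' <;> simp [hvGraph_adj, AdjRel, bit] at h hv hw ⊢ <;> omega

/-- An element with index `j < |l| − 1` lies in `l.dropLast`. [cite: MadrasSlade1993, §8.2 (8.2.1) (walks as vertex lists); lane plumbing] -/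
theorem getElem_mem_dropLast {α : Type*} {l : List α} {j : ℕ} (hj : j + 1 < l.length) :
    l[j]'(by omega) ∈ l.dropLast := by
  rw [List.dropLast_eq_take]
  have h : (l.take (l.length - 1))[j]'(by simp; omega) = l[j] := List.getElem_take
  rw [← h]
  exact List.getElem_mem _

/-- **In a bottom-avoiding chain of `S_T`, `T ≥ 2`, every vertex other than the first and the last two lies on a level `≥ 2`**
(a level-one vertex inside would have both its chain-neighbours equal to the vertex above it).
[cite: DuminilCopinSmirnov2012, §3 (the strip S_T: type-1 vertices have two edges down, one up); lane] -/
theorem two_le_lev_getElem {l : List HV} (hc : l.IsChain hvGraph.Adj) (hnd : l.Nodup) (hin : InLev T l)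
    (hbot : ∀ v ∈ l.dropLast, lev v ≠ 0) {i : ℕ} (hi1 : 1 ≤ i) (hi : i + 3 ≤ l.length) :
    2 ≤ lev (l[i]'(by omega)) := by
  have h0 : ∀ (j : ℕ) (hj : j + 1 < l.length), lev (l[j]'(by omega)) ≠ 0 := fun j hj => hbot _ (getElem_mem_dropLast hj)
  have hge := (hin _ (List.getElem_mem (l := l) (n := i) (by omega))).1
  by_contra hlt
  have h1 : lev (l[i]'(by omega)) = 1 := by have := h0 i (by omega); omega
  obtain ⟨k, rfl⟩ : ∃ k, i = k + 1 := ⟨i - 1, by omega⟩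
  have hch := List.isChain_iff_getElem.1 hc
  have ha : hvGraph.Adj (l[k]'(by omega)) (l[k + 1]'(by omega)) := hch k (by omega)
  have hb : hvGraph.Adj (l[k + 1]'(by omega)) (l[k + 1 + 1]'(by omega)) := hch (k + 1) (by omega)
  have e1 := eq_up_of_lev_one h1 ha.symm (h0 k (by omega))
  have e2 := eq_up_of_lev_one h1 hb (h0 (k + 1 + 1) (by omega))
  have := (hnd.getElem_inj_iff).1 (e1.trans e2.symm)
  omega


/-- `topCnt` is monotone along sublists. [cite: BeatonBousquetMelouDeGierDuminilCopinGuttmann2014, §3.2; lane plumbing] -/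
theorem topCnt_le_of_sublist (T : ℕ) {l₁ l₂ : List HV} (h : l₁.Sublist l₂) : topCnt T l₁ ≤ topCnt T l₂ :=
  (h.filter _).length_le

/-- Shifting down one level pair lowers the level by two. [cite: DuminilCopinSmirnov2012, §3; lane plumbing] -/
@[simp] theorem lev_shift_down (v : HV) : lev (shift 0 (-1) v) = lev v - 2 := by
  obtain ⟨a, b, c⟩ := v; cases c <;> simp [bit] <;> ring

/-- `topCnt` after shifting down one level pair: the top level `2T − 1` becomes `2(T−1) − 1`. [cite: BeatonBousquetMelouDeGierDuminilCopinGuttmann2014, §3.2; lane plumbing] -/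
theorem topCnt_shift_down (hT : 1 ≤ T) (l : List HV) : topCnt (T - 1) (l.map (shift 0 (-1))) = topCnt T l := by
  have hc : ((T - 1 : ℕ) : ℤ) = (T : ℤ) - 1 := by push_cast [Nat.cast_sub hT]; ring
  induction l with
  | nil => rfl
  | cons v l ih =>
    rw [List.map_cons, topCnt_cons, topCnt_cons, ih, lev_shift_down, hc]
    congr 1
    split_ifs with h1 h2 h2 <;> first | rfl | omega

/-- The first two vertices (plumbing). [folklore] -/
def bP (l : List HV) : List HV := l.take 2
/-- The middle `l[1 .. |l|−3]` (plumbing). [folklore] -/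
def bMid (l : List HV) : List HV := (l.drop 1).take (l.length - 3)
/-- The middle, shifted down one level pair and standardised (plumbing). [folklore] -/
def bM (l : List HV) : List HV := xstd ((bMid l).map (shift 0 (-1)))
/-- The last three vertices, standardised (plumbing). [folklore] -/
def bE (l : List HV) : List HV := xstd (l.drop (l.length - 3))
/-- The three-piece split of a long bottom-avoiding chain (plumbing). [folklore] -/
def bSplit (l : List HV) : List HV × List HV × List HV := (bP l, bM l, bE l)
/-- The product weight of a split (plumbing). [folklore] -/
def tripWt (T : ℕ) (y : ℝ) (t : List HV × List HV × List HV) : ℝ :=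
  hexCriticalFugacity * y ^ topCnt T t.1 * (cwt (T - 1) y t.2.1 * (hexCriticalFugacity ^ 2 * y ^ topCnt T t.2.2))

/-- `tripWt ≥ 0` (`y ≥ 0`). [cite: BeatonBousquetMelouDeGierDuminilCopinGuttmann2014, §3.2 (non-negative weights); lane plumbing] -/
theorem tripWt_nonneg (T : ℕ) {y : ℝ} (hy : 0 ≤ y) (t : List HV × List HV × List HV) : 0 ≤ tripWt T y t := by
  have hx := hexCriticalFugacity_pos_lt_one.1.le
  unfold tripWt
  exact mul_nonneg (mul_nonneg hx (pow_nonneg hy _)) (mul_nonneg (cwt_nonneg _ hy _) (mul_nonneg (pow_nonneg hx _) (pow_nonneg hy _)))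

section BSplit

variable {N : ℕ} {l : List HV} {y : ℝ}

/-- Unpacking membership in the long part of `botAvoidN`. [cite: BeatonBousquetMelouDeGierDuminilCopinGuttmann2014, §3.2; lane plumbing] -/
theorem of_mem_botAvoidN (hl : l ∈ botAvoidN T N) :
    l.IsChain hvGraph.Adj ∧ l.Nodup ∧ l.length - 1 ≤ N ∧ (∃ v, l.head? = some v ∧ v.1 = 0) ∧ InLev T l ∧
      (∀ v ∈ l.dropLast, lev v ≠ 0) ∧ l ≠ [] := by
  rw [botAvoidN, mem_filter, mem_chainsUpTo_iff] at hl
  obtain ⟨⟨n, hn, hsc⟩, hbot⟩ := hl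
  obtain ⟨hc, hnd, hlen, hh, hin⟩ := mem_stripChains_iff.1 hsc
  exact ⟨hc, hnd, by omega, hh, hin, hbot, ne_nil_of_mem_stripChains hsc⟩

/-- `l = l[0..0] ++ bMid l ++ l[|l|−2 ..]` for `|l| ≥ 4`. [cite: MadrasSlade1993, §8.2 (8.2.2) (splitting a walk); lane plumbing] -/
theorem take_append_bMid_append (h4 : 4 ≤ l.length) : l.take 1 ++ bMid l ++ l.drop (l.length - 2) = l := by
  have h1 : l.drop (l.length - 2) = (l.drop 1).drop (l.length - 3) := by
    rw [List.drop_drop]; congr 1; omega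
  rw [h1, bMid, List.append_assoc, List.take_append_drop, List.take_append_drop]

/-- The first piece is a one-step chain of `S_T`. [cite: MadrasSlade1993, §8.2; lane plumbing] -/
theorem bP_mem (hl : l ∈ botAvoidN T N) (h4 : 4 ≤ l.length) : bP l ∈ stripChains T 1 := by
  obtain ⟨hc, hnd, -, ⟨v, hh, hv⟩, hin, -, -⟩ := of_mem_botAvoidN hl
  rw [mem_stripChains_iff, bP]
  refine ⟨hc.take _, hnd.sublist (List.take_sublist _ _), by rw [List.length_take]; omega,
    ⟨v, by rw [List.head?_take]; simpa using hh, hv⟩, fun w hw => hin w ((List.take_sublist _ _).subset hw)⟩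

/-- The middle piece, shifted down, is a chain of `S_{T−1}` with `|l| − 4` steps (`T ≥ 2`): its vertices lie on levels `≥ 2`.
[cite: BeatonBousquetMelouDeGierDuminilCopinGuttmann2014, Corollary 8 proof (arXiv v5 p. 13: comparison of the strips of widths T and T−1); lane] -/
theorem bM_mem_stripChains (hT : 2 ≤ T) (hl : l ∈ botAvoidN T N) (h4 : 4 ≤ l.length) :
    bM l ∈ stripChains (T - 1) (l.length - 4) := by
  obtain ⟨hc, hnd, -, -, hin, hbot, -⟩ := of_mem_botAvoidN hl
  have hcT : ((T - 1 : ℕ) : ℤ) = (T : ℤ) - 1 := by push_cast [Nat.cast_sub (show 1 ≤ T by omega)]; ring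
  have hlenMid : (bMid l).length = l.length - 3 := by rw [bMid, List.length_take, List.length_drop]; omega
  -- levels of the middle
  have hlev : ∀ v ∈ bMid l, 2 ≤ lev v ∧ lev v ≤ 2 * (T : ℤ) - 1 := by
    intro v hv
    obtain ⟨i, hi, rfl⟩ := List.mem_iff_getElem.1 hv
    rw [hlenMid] at hi
    simp only [bMid, List.getElem_take, List.getElem_drop]
    exact ⟨two_le_lev_getElem hc hnd hin hbot (by omega) (by omega),
      (hin _ (List.getElem_mem (l := l) (n := 1 + i) (by omega))).2⟩
  have hcMid : (bMid l).IsChain hvGraph.Adj := (hc.drop 1).take _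
  have hndMid : (bMid l).Nodup := (hnd.sublist (List.drop_sublist _ _)).sublist (List.take_sublist _ _)
  have hne : bMid l ≠ [] := by rw [← List.length_pos_iff_ne_nil, hlenMid]; omega
  rw [mem_stripChains_iff, bM]
  refine ⟨isChain_xstd ?_, nodup_xstd (hndMid.map (shift 0 (-1)).injective),
    by rw [length_xstd, List.length_map, hlenMid]; omega, ?_, inLev_xstd ?_⟩
  · rw [List.isChain_map]
    exact hcMid.imp fun a b h => (shift 0 (-1)).map_rel_iff.2 h
  · obtain ⟨w, hw⟩ := List.exists_mem_of_ne_nil _ hne  -- dummy to get head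
    have hh : ((bMid l).map (shift 0 (-1))).head? = some (shift 0 (-1) ((bMid l).head hne)) := by
      rw [List.head?_map, List.head?_eq_some_head hne, Option.map_some]
    exact ⟨_, head?_xstd hh, rfl⟩
  · intro v hv
    rw [List.mem_map] at hv
    obtain ⟨w, hw, rfl⟩ := hv
    have := hlev w hw
    rw [lev_shift_down, hcT]
    omega

/-- The middle piece lies in `chainsUpTo (T−1) N`. [cite: BeatonBousquetMelouDeGierDuminilCopinGuttmann2014, Corollary 8 proof; lane plumbing] -/
theorem bM_mem (hT : 2 ≤ T) (hl : l ∈ botAvoidN T N) (h4 : 4 ≤ l.length) : bM l ∈ chainsUpTo (T - 1) N := by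
  obtain ⟨-, -, hN, -⟩ := of_mem_botAvoidN hl
  exact mem_chainsUpTo_of_mem (bM_mem_stripChains hT hl h4) (by omega)

/-- The last piece is a two-step chain of `S_T`. [cite: MadrasSlade1993, §8.2; lane plumbing] -/
theorem bE_mem (hl : l ∈ botAvoidN T N) (h4 : 4 ≤ l.length) : bE l ∈ stripChains T 2 := by
  obtain ⟨hc, hnd, -, -, hin, -, -⟩ := of_mem_botAvoidN hl
  have hlen : (l.drop (l.length - 3)).length = 3 := by rw [List.length_drop]; omega
  have hne : l.drop (l.length - 3) ≠ [] := by rw [← List.length_pos_iff_ne_nil, hlen]; omega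
  rw [mem_stripChains_iff, bE]
  refine ⟨isChain_xstd (hc.drop _), nodup_xstd (hnd.sublist (List.drop_sublist _ _)),
    by rw [length_xstd, hlen], ?_, inLev_xstd fun w hw => hin w ((List.drop_sublist _ _).subset hw)⟩
  exact ⟨_, head?_xstd (List.head?_eq_some_head hne), rfl⟩

/-- The split lands in the product class. [cite: BeatonBousquetMelouDeGierDuminilCopinGuttmann2014, §3.2; lane plumbing] -/
theorem bSplit_mem (hT : 2 ≤ T) (hl : l ∈ botAvoidN T N) (h4 : 4 ≤ l.length) :
    bSplit l ∈ stripChains T 1 ×ˢ (chainsUpTo (T - 1) N ×ˢ stripChains T 2) :=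
  mem_product.2 ⟨bP_mem hl h4, mem_product.2 ⟨bM_mem hT hl h4, bE_mem hl h4⟩⟩

/-- **Weights**: `x_c^{|l|−1} y^{#top(l)} ≤ tripWt (bSplit l)` for `y ≥ 1` (the two overlap vertices are over-counted).
[cite: BeatonBousquetMelouDeGierDuminilCopinGuttmann2014, §3.2; lane plumbing] -/
theorem cwt_le_tripWt (hT : 1 ≤ T) (hy1 : 1 ≤ y) (h4 : 4 ≤ l.length) : cwt T y l ≤ tripWt T y (bSplit l) := by
  have hx := hexCriticalFugacity_pos_lt_one.1
  have hlenMid : (bMid l).length = l.length - 3 := by rw [bMid, List.length_take, List.length_drop]; omega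
  -- top counts
  have htop : topCnt T l ≤ topCnt T (bP l) + topCnt (T - 1) (bM l) + topCnt T (bE l) := by
    have e : topCnt T l = topCnt T (l.take 1) + topCnt T (bMid l) + topCnt T (l.drop (l.length - 2)) := by
      conv_lhs => rw [← take_append_bMid_append h4]
      rw [topCnt_append, topCnt_append]
    have h1 : topCnt T (l.take 1) ≤ topCnt T (bP l) := by
      refine topCnt_le_of_sublist T ?_
      have : l.take 1 = (l.take 2).take 1 := by rw [List.take_take]; norm_num
      rw [bP, this]; exact List.take_sublist _ _
    have h2 : topCnt (T - 1) (bM l) = topCnt T (bMid l) := by rw [bM, topCnt_xstd, topCnt_shift_down hT]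
    have h3 : topCnt T (l.drop (l.length - 2)) ≤ topCnt T (bE l) := by
      rw [bE, topCnt_xstd]
      refine topCnt_le_of_sublist T ?_
      have : l.drop (l.length - 2) = (l.drop (l.length - 3)).drop 1 := by rw [List.drop_drop]; congr 1; omega
      rw [this]; exact List.drop_sublist _ _
    omega
  have hlenM : (bM l).length - 1 = l.length - 4 := by rw [bM, length_xstd, List.length_map, hlenMid]; omega
  have e1 : tripWt T y (bSplit l) = hexCriticalFugacity ^ (1 + (l.length - 4) + 2) *
      y ^ (topCnt T (bP l) + topCnt (T - 1) (bM l) + topCnt T (bE l)) := by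
    simp only [tripWt, bSplit, cwt, hlenM, pow_add, pow_one]
    ring
  have e2 : 1 + (l.length - 4) + 2 = l.length - 1 := by omega
  rw [e1, e2, cwt]
  exact mul_le_mul_of_nonneg_left (pow_le_pow_right₀ hy1 htop) (pow_nonneg hx.le _)

/-- **The split is injective** on the long bottom-avoiding chains. [cite: MadrasSlade1993, §8.2; lane plumbing] -/
theorem bSplit_injOn (T N : ℕ) :
    Set.InjOn bSplit ((botAvoidN T N).filter fun l => 4 ≤ l.length : Set (List HV)) := by
  intro l hl l' hl' h
  rw [mem_coe, mem_filter] at hl hl'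
  obtain ⟨-, h4⟩ := hl
  obtain ⟨-, h4'⟩ := hl'
  simp only [bSplit, Prod.mk.injEq] at h
  obtain ⟨hP, hM, hE⟩ := h
  -- lengths agree
  have hL : l.length = l'.length := by
    have := congrArg List.length hM
    simp only [bM, bMid, length_xstd, List.length_map, List.length_take, List.length_drop] at this
    omega
  -- the second vertices agree, hence the middles
  have h1 : l[1]'(by omega) = l'[1]'(by omega) := by
    have e : (l.take 2)[1]? = (l'.take 2)[1]? := by rw [← bP, ← bP, hP]
    rw [List.getElem?_take_of_lt (by norm_num), List.getElem?_take_of_lt (by norm_num),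
      List.getElem?_eq_getElem (by omega), List.getElem?_eq_getElem (by omega), Option.some_inj] at e
    exact e
  have hMid : bMid l = bMid l' := by
    have hm : (bMid l).map (shift 0 (-1)) = (bMid l').map (shift 0 (-1)) := by
      refine xstd_inj_of_head hM ?_
      rw [List.head?_map, List.head?_map, bMid, bMid, List.head?_take, List.head?_take, List.head?_drop, List.head?_drop,
        List.getElem?_eq_getElem (by omega), List.getElem?_eq_getElem (by omega), h1]
      simp only [hL]
    exact (List.map_injective_iff.2 (RelIso.injective _)) hm
  -- the vertex `l[|l|−3]` is the last of the middle, hence the ends agree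
  have hlenMid : (bMid l).length = l.length - 3 := by rw [bMid, List.length_take, List.length_drop]; omega
  have h3 : l[1 + (l.length - 4)]'(by omega) = l'[1 + (l.length - 4)]'(by omega) := by
    have e := List.getElem_of_eq hMid (i := l.length - 4) (by rw [hlenMid]; omega)
    simpa only [bMid, List.getElem_take, List.getElem_drop] using e
  have hEnd : l.drop (l.length - 3) = l'.drop (l'.length - 3) := by
    refine xstd_inj_of_head hE ?_
    rw [List.head?_drop, List.head?_drop, show l.length - 3 = 1 + (l.length - 4) by omega,
      show l'.length - 3 = 1 + (l.length - 4) by omega, List.getElem?_eq_getElem (by omega),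
      List.getElem?_eq_getElem (by omega), h3]
  have hTake : l.take 1 = l'.take 1 := by
    have := congrArg (List.take 1) hP
    simp only [bP, List.take_take] at this
    simpa using this
  have hD : l.drop (l.length - 2) = l'.drop (l'.length - 2) := by
    have e1 : l.drop (l.length - 2) = (l.drop (l.length - 3)).drop 1 := by rw [List.drop_drop]; congr 1; omega
    have e2 : l'.drop (l'.length - 2) = (l'.drop (l'.length - 3)).drop 1 := by rw [List.drop_drop]; congr 1; omega
    rw [e1, e2, hEnd]
  calc l = l.take 1 ++ bMid l ++ l.drop (l.length - 2) := (take_append_bMid_append h4).symm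
    _ = l'.take 1 ++ bMid l' ++ l'.drop (l'.length - 2) := by rw [hTake, hMid, hD]
    _ = l' := take_append_bMid_append h4'

end BSplit

/-- ★ **The bottom-avoiding class has bounded total weight** for `T ≥ 2` and `1 ≤ y < y_{T−1}`: `𝔅_{T,N}(y) ≤ C` uniformly in `N`.
A bottom-avoiding chain has its vertices `1, …, |l|−3` on the levels `2 … 2T−1`, i.e. (one level pair down) in the strip of width
`T − 1`, where the series `Σ_n x_c^n Z_{T−1,n}(y)` converges because `y < y_{T−1}`.
[cite: BeatonBousquetMelouDeGierDuminilCopinGuttmann2014, Corollary 8 and its proof (arXiv v5 pp. 12–13: radius y_T; "y_{T+1} < y_T"); lane] -/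
theorem exists_botAvoidSum_le (hT : 2 ≤ T) {y : ℝ} (hy1 : 1 ≤ y) (hyT : y < stripYT (T - 1)) :
    ∃ C : ℝ, ∀ N, botAvoidSum T N y ≤ C := by
  classical
  have hx := hexCriticalFugacity_pos_lt_one.1
  have hy0 : 0 ≤ y := by linarith
  have hT1 : 1 ≤ T - 1 := by omega
  obtain ⟨S, hS0, hS⟩ := exists_partialSum_le hT1 (by linarith) hyT
  set K₀ : ℝ := ∑ n ∈ range 3, hexCriticalFugacity ^ n * stripZL T n y with hK₀
  set Z₁ : ℝ := ∑ P ∈ stripChains T 1, hexCriticalFugacity * y ^ topCnt T P with hZ₁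
  set Z₂ : ℝ := ∑ E ∈ stripChains T 2, hexCriticalFugacity ^ 2 * y ^ topCnt T E with hZ₂
  have hZ₁0 : 0 ≤ Z₁ := sum_nonneg fun _ _ => by positivity
  have hZ₂0 : 0 ≤ Z₂ := sum_nonneg fun _ _ => by positivity
  refine ⟨K₀ + Z₁ * (S * Z₂), fun N => ?_⟩
  rw [botAvoidSum, ← sum_filter_add_sum_filter_not (botAvoidN T N) (fun l => 4 ≤ l.length)]
  rw [add_comm]
  refine add_le_add ?_ ?_
  · -- short lists: at most two steps
    calc ∑ l ∈ (botAvoidN T N).filter (fun l => ¬ 4 ≤ l.length), cwt T y l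
        ≤ ∑ l ∈ chainsUpTo T 2, cwt T y l := by
          refine sum_le_sum_of_subset_of_nonneg (fun l hl => ?_) fun l _ _ => cwt_nonneg T hy0 l
          rw [mem_filter] at hl
          obtain ⟨hl, h4⟩ := hl
          rw [botAvoidN, mem_filter, mem_chainsUpTo_iff] at hl
          obtain ⟨⟨n, -, hsc⟩, -⟩ := hl
          have := (mem_stripChains_iff.1 hsc).2.2.1
          exact mem_chainsUpTo_of_mem hsc (by omega)
      _ = K₀ := by rw [hK₀, sum_cwt_chainsUpTo]
  · -- long lists: the three-piece split
    calc ∑ l ∈ (botAvoidN T N).filter (fun l => 4 ≤ l.length), cwt T y l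
        ≤ ∑ l ∈ (botAvoidN T N).filter (fun l => 4 ≤ l.length), tripWt T y (bSplit l) :=
          sum_le_sum fun l hl => cwt_le_tripWt (by omega) hy1 (mem_filter.1 hl).2
      _ ≤ ∑ t ∈ stripChains T 1 ×ˢ (chainsUpTo (T - 1) N ×ˢ stripChains T 2), tripWt T y t :=
          sum_le_sum_of_injOn_of_nonneg bSplit (bSplit_injOn T N)
            (fun l hl => bSplit_mem hT (mem_filter.1 hl).1 (mem_filter.1 hl).2) _ fun t _ => tripWt_nonneg T hy0 t
      _ = Z₁ * ((∑ M ∈ chainsUpTo (T - 1) N, cwt (T - 1) y M) * Z₂) := by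
          rw [hZ₁, hZ₂, sum_mul_sum, sum_mul, sum_product]
          refine sum_congr rfl fun P _ => ?_
          rw [sum_product, mul_sum]
          refine sum_congr rfl fun M _ => ?_
          rw [mul_sum]
          refine sum_congr rfl fun E _ => ?_
          simp only [tripWt]
      _ ≤ Z₁ * (S * Z₂) := by
          refine mul_le_mul_of_nonneg_left (mul_le_mul_of_nonneg_right ?_ hZ₂0) hZ₁0
          rw [sum_cwt_chainsUpTo]
          exact hS N

/-! ### §3 The first bottom vertex and the last top vertex of a chain -/

/-- The indices of the vertices of `l` on the bottom level `0`. [cite: BeatonBousquetMelouDeGierDuminilCopinGuttmann2014, §3.2 (contacts with the bottom of the strip); lane plumbing] -/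
def botIdxs (l : List HV) : Finset ℕ := (range l.length).filter fun i => lev (l.getD i hvOrigin) = 0

/-- The indices of the vertices of `l` on the top level `2T − 1`. [cite: BeatonBousquetMelouDeGierDuminilCopinGuttmann2014, §3.2 (contacts with the top of the strip); lane plumbing] -/
def topIdxs (T : ℕ) (l : List HV) : Finset ℕ := (range l.length).filter fun i => lev (l.getD i hvOrigin) = 2 * (T : ℤ) - 1

/-- The index of the FIRST bottom vertex (`0` if none). [cite: BeatonBousquetMelouDeGierDuminilCopinGuttmann2014, §3.2; lane] -/
def jB (l : List HV) : ℕ := if h : (botIdxs l).Nonempty then (botIdxs l).min' h else 0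

/-- The index of the LAST top vertex (`0` if none). [cite: BeatonBousquetMelouDeGierDuminilCopinGuttmann2014, §3.2; lane] -/
def iT (T : ℕ) (l : List HV) : ℕ := if h : (topIdxs T l).Nonempty then (topIdxs T l).max' h else 0

/-- **The direct case**: some bottom vertex comes before some top vertex. [cite: BeatonBousquetMelouDeGierDuminilCopinGuttmann2014, §3.2; lane] -/
def CaseD (T : ℕ) (l : List HV) : Prop := ∃ a ∈ botIdxs l, ∃ b ∈ topIdxs T l, a < b

/-- Decidability of `CaseD`. [folklore] -/
instance (T : ℕ) (l : List HV) : Decidable (CaseD T l) := by unfold CaseD; infer_instance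

section Indices

variable {l : List HV} {i : ℕ}

/-- `getD` at an index in range is `getElem`. [cite: MadrasSlade1993, §8.2 (8.2.1) (walks as vertex lists); lane plumbing] -/
theorem getD_eq_getElem' (hi : i < l.length) : l.getD i hvOrigin = l[i] := by
  rw [List.getD_eq_getElem?_getD, List.getElem?_eq_getElem hi, Option.getD_some]

/-- Membership in `botIdxs`. [cite: BeatonBousquetMelouDeGierDuminilCopinGuttmann2014, §3.2 (contacts with the bottom of the strip); lane plumbing] -/
theorem mem_botIdxs_iff : i ∈ botIdxs l ↔ ∃ h : i < l.length, lev (l[i]'h) = 0 := by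
  rw [botIdxs, mem_filter, mem_range]
  constructor
  · rintro ⟨hi, h⟩; exact ⟨hi, by rwa [getD_eq_getElem' hi] at h⟩
  · rintro ⟨hi, h⟩; exact ⟨hi, by rwa [getD_eq_getElem' hi]⟩

/-- Membership in `topIdxs`. [cite: BeatonBousquetMelouDeGierDuminilCopinGuttmann2014, §3.2 (contacts with the top of the strip); lane plumbing] -/
theorem mem_topIdxs_iff : i ∈ topIdxs T l ↔ ∃ h : i < l.length, lev (l[i]'h) = 2 * (T : ℤ) - 1 := by
  rw [topIdxs, mem_filter, mem_range]
  constructor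
  · rintro ⟨hi, h⟩; exact ⟨hi, by rwa [getD_eq_getElem' hi] at h⟩
  · rintro ⟨hi, h⟩; exact ⟨hi, by rwa [getD_eq_getElem' hi]⟩

/-- In the direct case: `jB < iT`, both indices are in range, `l[jB]` is a bottom vertex and no earlier vertex is, `l[iT]` is a top
vertex and no later vertex is. [cite: BeatonBousquetMelouDeGierDuminilCopinGuttmann2014, §3.2; lane] -/
theorem caseD_spec (h : CaseD T l) :
    ∃ (hj : jB l < l.length) (hi : iT T l < l.length), jB l < iT T l ∧ lev (l[jB l]) = 0 ∧ lev (l[iT T l]) = 2 * (T : ℤ) - 1 ∧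
      (∀ (k : ℕ) (hk : k < l.length), k < jB l → lev (l[k]) ≠ 0) ∧
      (∀ (k : ℕ) (hk : k < l.length), iT T l < k → lev (l[k]) ≠ 2 * (T : ℤ) - 1) := by
  obtain ⟨a, ha, b, hb, hab⟩ := h
  have hB : (botIdxs l).Nonempty := ⟨a, ha⟩
  have hTn : (topIdxs T l).Nonempty := ⟨b, hb⟩
  have ej : jB l = (botIdxs l).min' hB := by rw [jB, dif_pos hB]
  have ei : iT T l = (topIdxs T l).max' hTn := by rw [iT, dif_pos hTn]
  have hjmem : jB l ∈ botIdxs l := by rw [ej]; exact min'_mem _ _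
  have himem : iT T l ∈ topIdxs T l := by rw [ei]; exact max'_mem _ _
  obtain ⟨hj, hjlev⟩ := mem_botIdxs_iff.1 hjmem
  obtain ⟨hi, hilev⟩ := mem_topIdxs_iff.1 himem
  have hja : jB l ≤ a := by rw [ej]; exact min'_le _ _ ha
  have hbi : b ≤ iT T l := by rw [ei]; exact le_max' _ _ hb
  refine ⟨hj, hi, by omega, hjlev, hilev, fun k hk hkj => ?_, fun k hk hik => ?_⟩
  · intro hk0
    have : jB l ≤ k := by rw [ej]; exact min'_le _ _ (mem_botIdxs_iff.2 ⟨hk, hk0⟩)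
    omega
  · intro hk1
    have : k ≤ iT T l := by rw [ei]; exact le_max' _ _ (mem_topIdxs_iff.2 ⟨hk, hk1⟩)
    omega

end Indices

/-! ### §4 The direct case: bottom-avoiding prefix ⊕ ONE β-walk ⊕ top-free suffix -/

/-- The prefix `l[0 .. jB]` (ends at the first bottom vertex). [cite: BeatonBousquetMelouDeGierDuminilCopinGuttmann2014, §3.2; lane] -/
def dA (l : List HV) : List HV := l.take (jB l + 1)

/-- The middle `l[jB .. iT]`, standardised: a β-walk of `S_{T,N}`. [cite: DuminilCopinSmirnov2012, §3 (walks a → β of S_{T,L}); lane] -/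
def dM (T : ℕ) (l : List HV) : List HV := xstd ((l.take (iT T l + 1)).drop (jB l))

/-- The suffix `l[iT ..]`, standardised (top-free after its head). [cite: BeatonBousquetMelouDeGierDuminilCopinGuttmann2014, §3.2; lane] -/
def dC (T : ℕ) (l : List HV) : List HV := xstd (l.drop (iT T l))

/-- The three-piece split of the direct case. [cite: BeatonBousquetMelouDeGierDuminilCopinGuttmann2014, §3.2; lane] -/
def dSplit (T : ℕ) (l : List HV) : List HV × List HV × List HV := (dA l, dM T l, dC T l)

/-- The product weight of the direct split: `cwt(A) · (x_c⁻¹ · x_c^{|M|} y^{#top M}) · x_c^{|C|−1}`. [cite: BeatonBousquetMelouDeGierDuminilCopinGuttmann2014, §3.2; lane] -/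
def dWt (T : ℕ) (y : ℝ) (t : List HV × List HV × List HV) : ℝ :=
  cwt T y t.1 * (hexCriticalFugacity⁻¹ * (hexCriticalFugacity ^ t.2.1.length * y ^ topCnt T t.2.1) *
    hexCriticalFugacity ^ (t.2.2.length - 1))

/-- `dWt ≥ 0` (`y ≥ 0`). [cite: BeatonBousquetMelouDeGierDuminilCopinGuttmann2014, §3.2 (non-negative weights); lane plumbing] -/
theorem dWt_nonneg (T : ℕ) {y : ℝ} (hy : 0 ≤ y) (t : List HV × List HV × List HV) : 0 ≤ dWt T y t := by
  have hx := hexCriticalFugacity_pos_lt_one.1.le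
  unfold dWt
  exact mul_nonneg (cwt_nonneg _ hy _) (mul_nonneg (mul_nonneg (inv_nonneg.2 hx) (mul_nonneg (pow_nonneg hx _) (pow_nonneg hy _)))
    (pow_nonneg hx _))

/-- The direct-case chains with at most `N` steps. [cite: BeatonBousquetMelouDeGierDuminilCopinGuttmann2014, §3.2; lane] -/
def caseDSet (T N : ℕ) : Finset (List HV) := (chainsUpTo T N).filter (CaseD T)

/-- Along an edge of `ℍ` the first coordinate changes by at most one. [cite: DuminilCopinSmirnov2012, §3 (the hexagonal lattice in coordinates); lane plumbing] -/
theorem fst_sub_le_one_of_adj {u v : HV} (h : hvGraph.Adj u v) : v.1 - u.1 ≤ 1 ∧ u.1 - v.1 ≤ 1 := by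
  obtain ⟨a, b, c⟩ := u
  obtain ⟨a', b', c'⟩ := v
  cases c <;> cases c' <;> simp [hvGraph_adj, AdjRel] at h ⊢ <;> omega

/-- Along a chain the first coordinate moves by at most the number of steps. [cite: DuminilCopinSmirnov2012, §3 (the hexagonal lattice in coordinates); lane plumbing] -/
theorem abs_fst_sub_le {l : List HV} (hc : l.IsChain hvGraph.Adj) {i k : ℕ} (hk : i + k < l.length) :
    (l[i + k]'hk).1 - (l[i]'(by omega)).1 ≤ k ∧ (l[i]'(by omega)).1 - (l[i + k]'hk).1 ≤ k := by
  induction k with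
  | zero => simp
  | succ k ih =>
    have ih' := ih (by omega)
    have hadj : hvGraph.Adj (l[i + k]'(by omega)) (l[i + (k + 1)]'hk) := by
      have := List.isChain_iff_getElem.1 hc (i + k) (by omega)
      simpa [Nat.add_assoc] using this
    have h1 := fst_sub_le_one_of_adj hadj
    push_cast
    omega

/-- A bottom vertex is `(x₀, 0, false)`. [cite: DuminilCopinSmirnov2012, §3] -/
theorem eq_of_lev_zero {v : HV} (h : lev v = 0) : v = (v.1, 0, false) := by
  obtain ⟨a, b, c⟩ := v
  cases c <;> simp [bit] at h ⊢ <;> omega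

section DSplit

variable {N : ℕ} {l : List HV} {y : ℝ}

/-- Unpacking membership in `caseDSet`. [cite: BeatonBousquetMelouDeGierDuminilCopinGuttmann2014, §3.2; lane plumbing] -/
theorem of_mem_caseDSet (hl : l ∈ caseDSet T N) :
    ∃ n, n ≤ N ∧ l ∈ stripChains T n ∧ l.IsChain hvGraph.Adj ∧ l.Nodup ∧ l.length = n + 1 ∧
      (∃ v, l.head? = some v ∧ v.1 = 0) ∧ InLev T l ∧ CaseD T l := by
  rw [caseDSet, mem_filter, mem_chainsUpTo_iff] at hl
  obtain ⟨⟨n, hn, hsc⟩, hD⟩ := hl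
  obtain ⟨hc, hnd, hlen, hh, hin⟩ := mem_stripChains_iff.1 hsc
  exact ⟨n, hn, hsc, hc, hnd, hlen, hh, hin, hD⟩

/-- The prefix is a bottom-avoiding chain with at most `N` steps. [cite: BeatonBousquetMelouDeGierDuminilCopinGuttmann2014, §3.2; lane] -/
theorem dA_mem (hl : l ∈ caseDSet T N) : dA l ∈ botAvoidN T N := by
  obtain ⟨n, hn, hsc, -, -, hlen, -, -, hD⟩ := of_mem_caseDSet hl
  obtain ⟨hj, -, -, -, -, hbef, -⟩ := caseD_spec hD
  have hsc' : l ∈ stripChains T (jB l + (n - jB l)) := by rwa [show jB l + (n - jB l) = n by omega]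
  have hA : dA l ∈ stripChains T (jB l) := splFst_mem hsc'
  rw [botAvoidN, mem_filter]
  refine ⟨mem_chainsUpTo_of_mem hA (by omega), fun v hv => ?_⟩
  rw [dA, List.dropLast_eq_take, List.take_take, List.length_take] at hv
  obtain ⟨k, hk, rfl⟩ := List.mem_iff_getElem.1 hv
  rw [List.length_take] at hk
  rw [List.getElem_take]
  exact hbef k (by omega) (by omega)

/-- The middle piece is a β-walk of `S_{T,N}` (`T ≥ 1`): from the first bottom vertex (moved to `O`) to the last top vertex, every
vertex within `N` columns of its start. [cite: DuminilCopinSmirnov2012, §3 (walks a → β of S_{T,L}); lane] -/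
theorem dM_mem (hT : 1 ≤ T) (hl : l ∈ caseDSet T N) : dM T l ∈ bridgeLists T N := by
  obtain ⟨n, hn, -, hc, hnd, hlen, -, hin, hD⟩ := of_mem_caseDSet hl
  obtain ⟨hj, hi, hji, hjlev, hilev, -, -⟩ := caseD_spec hD
  set seg := (l.take (iT T l + 1)).drop (jB l) with hseg
  have hlenS : seg.length = iT T l + 1 - jB l := by rw [hseg, List.length_drop, List.length_take]; omega
  have hne : seg ≠ [] := by rw [← List.length_pos_iff_ne_nil, hlenS]; omega
  have hgetS : ∀ (k : ℕ) (hk : k < seg.length), seg[k] = l[jB l + k]'(by rw [hlenS] at hk; omega) := by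
    intro k hk
    simp only [hseg, List.getElem_drop, List.getElem_take]
  have hhead : seg.head hne = l[jB l] := by
    rw [← List.getElem_zero (by rw [hlenS]; omega), hgetS 0]
    simp
  have hz := eq_of_lev_zero hjlev
  set a : ℤ := (l[jB l]).1 with ha
  have hxstd : dM T l = seg.map (shift (-a) 0) := by
    rw [dM, ← hseg, xstd, List.headD_eq_head?_getD, List.head?_eq_some_head hne, Option.getD_some, hhead]
  rw [mem_bridgeLists_iff hT]
  refine ⟨?_, ?_, ?_, ?_, ?_⟩
  · rw [dM]; exact isChain_xstd ((hc.take _).drop _)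
  · rw [hxstd, List.head?_map, List.head?_eq_some_head hne, hhead, Option.map_some, shift_apply]
    rw [hz]
    simp [hvOrigin, ha]
  · rw [dM]; exact nodup_xstd ((hnd.sublist (List.take_sublist _ _)).sublist (List.drop_sublist _ _))
  · intro v hv
    rw [hxstd, List.mem_map] at hv
    obtain ⟨w, hw, rfl⟩ := hv
    obtain ⟨k, hk, rfl⟩ := List.mem_iff_getElem.1 hw
    rw [hgetS k hk]
    rw [hlenS] at hk
    have hkN : k ≤ N := by omega
    have hdist := abs_fst_sub_le hc (i := jB l) (k := k) (by omega)
    have hlv := hin _ (List.getElem_mem (l := l) (n := jB l + k) (by omega))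
    rw [hz] at hdist
    rcases hvk : l[jB l + k] with ⟨p, q, b⟩
    rw [hvk] at hdist hlv
    rw [mem_stripV_iff]
    cases b <;> simp [bit, lev] at hlv hdist ⊢ <;> omega
  · refine ⟨by rw [hxstd]; simpa using hne, ?_⟩
    rw [List.getLast_eq_getElem]
    simp only [hxstd, List.getElem_map, lev_shift_zero, List.length_map]
    rw [hgetS _ (by rw [hlenS]; omega)]
    have e : jB l + (seg.length - 1) = iT T l := by rw [hlenS]; omega
    simp only [e]
    exact_mod_cast hilev

/-- The suffix is a chain of `S_T` with at most `N` steps. [cite: MadrasSlade1993, §8.2; lane plumbing] -/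
theorem dC_mem (hl : l ∈ caseDSet T N) : dC T l ∈ chainsUpTo T N := by
  obtain ⟨n, hn, hsc, -, -, hlen, -, -, hD⟩ := of_mem_caseDSet hl
  obtain ⟨-, hi, -⟩ := caseD_spec hD
  have hsc' : l ∈ stripChains T (iT T l + (n - iT T l)) := by rwa [show iT T l + (n - iT T l) = n by omega]
  have hC : dC T l ∈ stripChains T (n - iT T l) := splSnd_mem hsc'
  exact mem_chainsUpTo_of_mem hC (by omega)

/-- The direct split lands in the product class. [cite: BeatonBousquetMelouDeGierDuminilCopinGuttmann2014, §3.2; lane] -/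
theorem dSplit_mem (hT : 1 ≤ T) (hl : l ∈ caseDSet T N) :
    dSplit T l ∈ botAvoidN T N ×ˢ (bridgeLists T N ×ˢ chainsUpTo T N) :=
  mem_product.2 ⟨dA_mem hl, mem_product.2 ⟨dM_mem hT hl, dC_mem hl⟩⟩

/-- **Weights multiply exactly**: `x_c^{|l|−1} y^{#top(l)} = dWt (dSplit l)` — every top vertex of `l` lies in the prefix or in the
β-walk; the suffix after the last top vertex carries no `y`. [cite: BeatonBousquetMelouDeGierDuminilCopinGuttmann2014, §3.2; lane] -/
theorem cwt_eq_dWt (hl : l ∈ caseDSet T N) : cwt T y l = dWt T y (dSplit T l) := by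
  obtain ⟨n, -, -, -, -, hlen, -, -, hD⟩ := of_mem_caseDSet hl
  obtain ⟨hj, hi, hji, hjlev, hilev, -, haft⟩ := caseD_spec hD
  have hx := hexCriticalFugacity_pos_lt_one.1
  -- lengths
  have hlA : (dA l).length = jB l + 1 := by rw [dA, List.length_take]; omega
  have hlM : (dM T l).length = iT T l + 1 - jB l := by rw [dM, length_xstd, List.length_drop, List.length_take]; omega
  have hlC : (dC T l).length = n + 1 - iT T l := by rw [dC, length_xstd, List.length_drop]; omega
  -- top counts
  have e1 : l = l.take (jB l) ++ (l.take (iT T l + 1)).drop (jB l) ++ l.drop (iT T l + 1) := by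
    have h1 : l.take (jB l) = (l.take (iT T l + 1)).take (jB l) := by
      rw [List.take_take, min_eq_left (by omega)]
    rw [h1, List.take_append_drop, List.take_append_drop]
  have hA : topCnt T (dA l) = topCnt T (l.take (jB l)) := by
    rw [dA, List.take_add_one, List.getElem?_eq_getElem hj, topCnt_append]
    simp only [Option.toList_some, topCnt_singleton, hjlev]
    have : (0 : ℤ) ≠ 2 * (T : ℤ) - 1 := by omega
    simp [this]
  have hC : topCnt T (l.drop (iT T l + 1)) = 0 := by
    rw [topCnt, List.length_eq_zero_iff, List.filter_eq_nil_iff]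
    intro v hv
    obtain ⟨k, hk, rfl⟩ := List.mem_iff_getElem.1 hv
    rw [List.length_drop] at hk
    rw [List.getElem_drop]
    simpa using haft (iT T l + 1 + k) (by omega) (by omega)
  have htop : topCnt T l = topCnt T (dA l) + topCnt T (dM T l) := by
    conv_lhs => rw [e1]
    rw [topCnt_append, topCnt_append, hC, hA, dM, topCnt_xstd]
    ring
  -- assemble
  rw [cwt, htop, dWt, dSplit, cwt]
  simp only [hlA, hlM, hlC, hlen, pow_add]
  have e3 : hexCriticalFugacity⁻¹ * hexCriticalFugacity ^ (iT T l + 1 - jB l) = hexCriticalFugacity ^ (iT T l - jB l) := by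
    rw [show iT T l + 1 - jB l = (iT T l - jB l) + 1 by omega, pow_succ, mul_comm, mul_assoc,
      mul_inv_cancel₀ hx.ne', mul_one]
  have e2 : hexCriticalFugacity ^ (n + 1 - 1) = hexCriticalFugacity ^ (jB l + 1 - 1) *
      (hexCriticalFugacity⁻¹ * hexCriticalFugacity ^ (iT T l + 1 - jB l) * hexCriticalFugacity ^ (n + 1 - iT T l - 1)) := by
    rw [e3, ← pow_add, ← pow_add]
    congr 1; omega
  rw [e2]; ring

/-- **The direct split is injective** on `caseDSet T N`. [cite: MadrasSlade1993, §8.2 (translation classes); lane] -/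
theorem dSplit_injOn (T N : ℕ) : Set.InjOn (dSplit T) (caseDSet T N : Set (List HV)) := by
  intro l hl l' hl' h
  rw [mem_coe] at hl hl'
  obtain ⟨n, -, -, -, -, hlen, -, -, hD⟩ := of_mem_caseDSet hl
  obtain ⟨n', -, -, -, -, hlen', -, -, hD'⟩ := of_mem_caseDSet hl'
  obtain ⟨hj, hi, hji, -⟩ := caseD_spec hD
  obtain ⟨hj', hi', hji', -⟩ := caseD_spec hD'
  simp only [dSplit, Prod.mk.injEq] at h
  obtain ⟨hA, hM, hC⟩ := h
  -- the indices agree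
  have ej : jB l = jB l' := by
    have := congrArg List.length hA
    rw [dA, dA, List.length_take, List.length_take] at this
    omega
  have ei : iT T l = iT T l' := by
    have := congrArg List.length hM
    rw [dM, dM, length_xstd, length_xstd, List.length_drop, List.length_drop, List.length_take, List.length_take] at this
    omega
  rw [dA, dA, ← ej] at hA
  rw [dM, dM, ← ej, ← ei] at hM
  rw [dC, dC, ← ei] at hC
  -- the vertex `l[jB]` agrees, hence the middles
  have h1 : l[jB l] = l'[jB l]'(by omega) := by
    have e : (l.take (jB l + 1))[jB l]? = (l'.take (jB l + 1))[jB l]? := by rw [hA]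
    rwa [List.getElem?_take_of_lt (by omega), List.getElem?_take_of_lt (by omega), List.getElem?_eq_getElem hj,
      List.getElem?_eq_getElem (by omega), Option.some_inj] at e
  have hseg : (l.take (iT T l + 1)).drop (jB l) = (l'.take (iT T l + 1)).drop (jB l) := by
    refine xstd_inj_of_head hM ?_
    rw [List.head?_drop, List.head?_drop, List.getElem?_take_of_lt (by omega), List.getElem?_take_of_lt (by omega),
      List.getElem?_eq_getElem hj, List.getElem?_eq_getElem (by omega), h1]
  have htake : l.take (iT T l + 1) = l'.take (iT T l + 1) := by
    have e1 : (l.take (iT T l + 1)).take (jB l) = (l'.take (iT T l + 1)).take (jB l) := by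
      rw [List.take_take, List.take_take, min_eq_left (by omega)]
      have := congrArg (List.take (jB l)) hA
      rwa [List.take_take, List.take_take, min_eq_left (by omega)] at this
    calc l.take (iT T l + 1) = (l.take (iT T l + 1)).take (jB l) ++ (l.take (iT T l + 1)).drop (jB l) :=
        (List.take_append_drop _ _).symm
      _ = (l'.take (iT T l + 1)).take (jB l) ++ (l'.take (iT T l + 1)).drop (jB l) := by rw [e1, hseg]
      _ = l'.take (iT T l + 1) := List.take_append_drop _ _
  -- the vertex `l[iT]` agrees, hence the suffixes
  have h2 : l[iT T l] = l'[iT T l]'(by omega) := by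
    have e : (l.take (iT T l + 1))[iT T l]? = (l'.take (iT T l + 1))[iT T l]? := by rw [htake]
    rwa [List.getElem?_take_of_lt (by omega), List.getElem?_take_of_lt (by omega), List.getElem?_eq_getElem hi,
      List.getElem?_eq_getElem (by omega), Option.some_inj] at e
  have hdrop : l.drop (iT T l) = l'.drop (iT T l) := by
    refine xstd_inj_of_head hC ?_
    rw [List.head?_drop, List.head?_drop, List.getElem?_eq_getElem hi, List.getElem?_eq_getElem (by omega), h2]
  have htake' : l.take (iT T l) = l'.take (iT T l) := by
    have := congrArg (List.take (iT T l)) htake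
    rwa [List.take_take, List.take_take, min_eq_left (Nat.le_succ _)] at this
  calc l = l.take (iT T l) ++ l.drop (iT T l) := (List.take_append_drop _ _).symm
    _ = l'.take (iT T l) ++ l'.drop (iT T l) := by rw [htake', hdrop]
    _ = l' := List.take_append_drop _ _

/-- ★ **The direct-case sum is bounded by `𝔅 · x_c⁻¹ B_{T,N} · S`** where `S` bounds the `x_c`-weight of all chains:
`Σ_{l ∈ caseDSet T N} x_c^{|l|−1} y^{#top(l)} ≤ 𝔅_{T,N}(y) · (x_c⁻¹ B_{T,N}(x_c; y)) · Σ_{chainsUpTo T N} x_c^{|C|−1}` (`T ≥ 1`, `y ≥ 0`).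
[cite: BeatonBousquetMelouDeGierDuminilCopinGuttmann2014, §3.2–§3.3 (B_{T,L}(x_c; y)); lane: the linear chain-to-bridge comparison] -/
theorem sum_caseD_le (hT : 1 ≤ T) (hy : 0 ≤ y) (N : ℕ) :
    ∑ l ∈ caseDSet T N, cwt T y l ≤ botAvoidSum T N y * ((hexCriticalFugacity⁻¹ * stripGFy T N (IsBetaDart T) y) *
      ∑ C ∈ chainsUpTo T N, hexCriticalFugacity ^ (C.length - 1)) := by
  classical
  calc ∑ l ∈ caseDSet T N, cwt T y l = ∑ l ∈ caseDSet T N, dWt T y (dSplit T l) :=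
        sum_congr rfl fun l hl => cwt_eq_dWt hl
    _ ≤ ∑ t ∈ botAvoidN T N ×ˢ (bridgeLists T N ×ˢ chainsUpTo T N), dWt T y t :=
        sum_le_sum_of_injOn_of_nonneg (dSplit T) (dSplit_injOn T N) (fun l hl => dSplit_mem hT hl) _
          fun t _ => dWt_nonneg T hy t
    _ = botAvoidSum T N y * ((∑ M ∈ bridgeLists T N, hexCriticalFugacity⁻¹ * (hexCriticalFugacity ^ M.length * y ^ topCnt T M)) *
          ∑ C ∈ chainsUpTo T N, hexCriticalFugacity ^ (C.length - 1)) := by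
        rw [botAvoidSum]
        exact sum_triple_product _ _ _ (cwt T y)
          (fun M : List HV => hexCriticalFugacity⁻¹ * (hexCriticalFugacity ^ M.length * y ^ topCnt T M))
          (fun C : List HV => hexCriticalFugacity ^ (C.length - 1))
    _ = botAvoidSum T N y * ((hexCriticalFugacity⁻¹ * stripGFy T N (IsBetaDart T) y) *
          ∑ C ∈ chainsUpTo T N, hexCriticalFugacity ^ (C.length - 1)) := by
        have e : ∑ M ∈ bridgeLists T N, hexCriticalFugacity⁻¹ * (hexCriticalFugacity ^ M.length * y ^ topCnt T M) =
            hexCriticalFugacity⁻¹ * stripGFy T N (IsBetaDart T) y := by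
          rw [stripGFy_beta_eq_sum_bridgeLists hT, mul_sum]
          rfl
        rw [e]

end DSplit

/-! ### §5 Time reversal: the case «every top vertex before every bottom vertex» is the mirror image of the direct case -/

/-- Reverse a vertex list and standardise it horizontally. [cite: MadrasSlade1993, §8.2 (translation classes); lane plumbing] -/
def revStd (l : List HV) : List HV := xstd l.reverse

/-- `revStd` keeps lengths. [cite: MadrasSlade1993, §8.2 (8.2.1) (translation classes); lane plumbing] -/
@[simp] theorem length_revStd (l : List HV) : (revStd l).length = l.length := by rw [revStd, length_xstd, List.length_reverse]

/-- `revStd` keeps top counts. [cite: BeatonBousquetMelouDeGierDuminilCopinGuttmann2014, §3.2; lane plumbing] -/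
@[simp] theorem topCnt_revStd (T : ℕ) (l : List HV) : topCnt T (revStd l) = topCnt T l := by
  rw [revStd, topCnt_xstd, topCnt_reverse]

/-- `revStd` keeps the weight `cwt`. [cite: BeatonBousquetMelouDeGierDuminilCopinGuttmann2014, §3.2; lane plumbing] -/
theorem cwt_revStd (T : ℕ) (y : ℝ) (l : List HV) : cwt T y (revStd l) = cwt T y l := by
  rw [cwt, cwt, length_revStd, topCnt_revStd]

/-- `revStd` maps `n`-step chains of `S_T` to `n`-step chains of `S_T`. [cite: MadrasSlade1993, §8.2; lane plumbing] -/
theorem revStd_mem {T n : ℕ} {l : List HV} (hl : l ∈ stripChains T n) : revStd l ∈ stripChains T n := by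
  obtain ⟨hc, hnd, hlen, -, hin⟩ := mem_stripChains_iff.1 hl
  have hne : l.reverse ≠ [] := by rw [ne_eq, List.reverse_eq_nil_iff]; exact ne_nil_of_mem_stripChains hl
  rw [mem_stripChains_iff, revStd]
  refine ⟨isChain_xstd ?_, nodup_xstd (List.nodup_reverse.2 hnd), by rw [length_xstd, List.length_reverse, hlen], ?_,
    inLev_xstd fun v hv => hin v (List.mem_reverse.1 hv)⟩
  · rw [List.isChain_reverse]
    exact hc.imp fun a b (h : hvGraph.Adj a b) => h.symm
  · exact ⟨_, head?_xstd (List.head?_eq_some_head hne), rfl⟩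


/-- Shifting by `a` and then by `−a` is the identity on lists. [cite: MadrasSlade1993, §8.2 (8.2.1) (translation classes); lane plumbing] -/
theorem map_shift_neg_map_shift (a : ℤ) (l : List HV) : (l.map (shift a 0)).map (shift (-a) 0) = l := by
  rw [List.map_map]
  conv_rhs => rw [← List.map_id l]
  refine List.map_congr_left fun w _ => ?_
  obtain ⟨p, q, b⟩ := w
  simp

/-- `revStd` is injective on the chains with standard head. [cite: MadrasSlade1993, §8.2 (translation classes); lane plumbing] -/
theorem revStd_injOn (T N : ℕ) : Set.InjOn revStd (chainsUpTo T N : Set (List HV)) := by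
  intro l hl l' hl' h
  rw [mem_coe, mem_chainsUpTo_iff] at hl hl'
  obtain ⟨n, -, hl⟩ := hl
  obtain ⟨n', -, hl'⟩ := hl'
  obtain ⟨-, -, -, ⟨v, hv, hv0⟩, -⟩ := mem_stripChains_iff.1 hl
  obtain ⟨-, -, -, ⟨v', hv', hv0'⟩, -⟩ := mem_stripChains_iff.1 hl'
  -- undo the standardisations
  set a : ℤ := (l.reverse.headD hvOrigin).1
  set a' : ℤ := (l'.reverse.headD hvOrigin).1
  have e1 : l.reverse = (xstd l.reverse).map (shift a 0) := (map_shift_xstd _).symm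
  have e2 : l'.reverse = (xstd l'.reverse).map (shift a' 0) := (map_shift_xstd _).symm
  rw [revStd, revStd] at h
  rw [h] at e1
  -- so `l.reverse = l'.reverse` shifted by `a − a'`
  have e3 : l.reverse = l'.reverse.map (shift (a - a') 0) := by
    have hX : xstd l'.reverse = l'.reverse.map (shift (-a') 0) := by
      have h2 := congrArg (List.map (shift (-a') 0)) e2
      rw [map_shift_neg_map_shift] at h2
      exact h2.symm
    rw [e1, hX, List.map_map]
    refine List.map_congr_left fun w _ => ?_
    obtain ⟨p, q, b⟩ := w
    simp only [Function.comp_apply, shift_apply, add_zero, Prod.mk.injEq, and_true]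
    ring
  have e4 : l = l'.map (shift (a - a') 0) := by
    have := congrArg List.reverse e3
    rwa [List.reverse_reverse, List.map_reverse, List.reverse_reverse] at this
  -- compare heads: both have first coordinate zero
  have hsh : a - a' = 0 := by
    rw [e4, List.head?_map, hv', Option.map_some] at hv
    have := congrArg (fun o : Option HV => (o.getD hvOrigin).1) hv
    simp only [Option.getD_some, shift_apply] at this
    rw [hv0', hv0] at this
    linarith
  rw [e4, hsh]
  conv_rhs => rw [← List.map_id l']
  refine List.map_congr_left fun w _ => ?_
  obtain ⟨p, q, b⟩ := w; simp

/-- Elements of `revStd l`: `(revStd l)[i]` is a horizontal translate of `l[|l| − 1 − i]`, so it has the same level. [cite: MadrasSlade1993, §8.2 (8.2.1) (translation classes); lane plumbing] -/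
theorem lev_getElem_revStd {l : List HV} {i : ℕ} (hi : i < (revStd l).length) :
    lev ((revStd l)[i]) = lev (l[l.length - 1 - i]'(by rw [length_revStd] at hi; omega)) := by
  simp only [revStd, xstd, List.getElem_map, lev_shift_zero, List.getElem_reverse]

/-- **The reversed case maps into the direct case**: if `l` has a top vertex and a bottom vertex but is not in the direct case
(every top vertex precedes every bottom vertex), then `revStd l` is in the direct case.
[cite: BeatonBousquetMelouDeGierDuminilCopinGuttmann2014, §3.2; lane] -/
theorem caseD_revStd {l : List HV} (htop : (topIdxs T l).Nonempty) (hbot : (botIdxs l).Nonempty) (hD : ¬ CaseD T l) :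
    CaseD T (revStd l) := by
  obtain ⟨b, hb⟩ := htop
  obtain ⟨a, ha⟩ := hbot
  obtain ⟨hbl, hblev⟩ := mem_topIdxs_iff.1 hb
  obtain ⟨hal, halev⟩ := mem_botIdxs_iff.1 ha
  have hba : b < a := by
    by_contra hle
    rcases (not_lt.1 hle).lt_or_eq with hlt | heq
    · exact hD ⟨a, ha, b, hb, hlt⟩
    · subst heq; rw [halev] at hblev; omega
  have hlen : (revStd l).length = l.length := length_revStd l
  refine ⟨l.length - 1 - a, mem_botIdxs_iff.2 ⟨by rw [hlen]; omega, ?_⟩, l.length - 1 - b,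
    mem_topIdxs_iff.2 ⟨by rw [hlen]; omega, ?_⟩, by omega⟩
  · rw [lev_getElem_revStd]
    have e : l.length - 1 - (l.length - 1 - a) = a := by omega
    simp only [e]; exact halev
  · rw [lev_getElem_revStd]
    have e : l.length - 1 - (l.length - 1 - b) = b := by omega
    simp only [e]; exact hblev

/-- The reversed-case chains with at most `N` steps. [cite: BeatonBousquetMelouDeGierDuminilCopinGuttmann2014, §3.2; lane] -/
def caseRSet (T N : ℕ) : Finset (List HV) :=
  (chainsUpTo T N).filter fun l => (topIdxs T l).Nonempty ∧ (botIdxs l).Nonempty ∧ ¬ CaseD T l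

/-- **The reversed-case sum is at most the direct-case sum** (`y ≥ 0`). [cite: BeatonBousquetMelouDeGierDuminilCopinGuttmann2014, §3.2; lane] -/
theorem sum_caseR_le (T N : ℕ) {y : ℝ} (hy : 0 ≤ y) :
    ∑ l ∈ caseRSet T N, cwt T y l ≤ ∑ l ∈ caseDSet T N, cwt T y l := by
  calc ∑ l ∈ caseRSet T N, cwt T y l = ∑ l ∈ caseRSet T N, cwt T y (revStd l) :=
        sum_congr rfl fun l _ => (cwt_revStd T y l).symm
    _ ≤ ∑ l ∈ caseDSet T N, cwt T y l := by
        have hsub : (caseRSet T N : Set (List HV)) ⊆ (chainsUpTo T N : Set (List HV)) := by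
          intro l hl
          rw [mem_coe] at hl ⊢
          unfold caseRSet at hl
          exact (mem_filter.1 hl).1
        refine sum_le_sum_of_injOn_of_nonneg revStd ((revStd_injOn T N).mono hsub)
          (fun l hl => ?_) _ fun l _ => cwt_nonneg T hy l
        unfold caseRSet at hl
        rw [mem_filter, mem_chainsUpTo_iff] at hl
        obtain ⟨⟨n, hn, hsc⟩, htop, hbot, hD⟩ := hl
        rw [caseDSet, mem_filter]
        exact ⟨mem_chainsUpTo_of_mem (revStd_mem hsc) hn, caseD_revStd htop hbot hD⟩

/-! ### §6 Assembly: the linear chain-to-bridge comparison -/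

/-- A chain without top vertices has `topCnt = 0`. [cite: BeatonBousquetMelouDeGierDuminilCopinGuttmann2014, §3.2; lane plumbing] -/
theorem topCnt_eq_zero_of_not_nonempty {l : List HV} (h : ¬ (topIdxs T l).Nonempty) : topCnt T l = 0 := by
  rw [topCnt, List.length_eq_zero_iff, List.filter_eq_nil_iff]
  intro v hv
  obtain ⟨i, hi, rfl⟩ := List.mem_iff_getElem.1 hv
  intro htop
  exact h ⟨i, mem_topIdxs_iff.2 ⟨hi, by simpa using htop⟩⟩

/-- A chain without bottom vertices is bottom-avoiding. [cite: BeatonBousquetMelouDeGierDuminilCopinGuttmann2014, §3.2; lane plumbing] -/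
theorem mem_botAvoidN_of_not_nonempty {N : ℕ} {l : List HV} (hl : l ∈ chainsUpTo T N) (h : ¬ (botIdxs l).Nonempty) :
    l ∈ botAvoidN T N := by
  rw [botAvoidN, mem_filter]
  refine ⟨hl, fun v hv hv0 => ?_⟩
  have hv' : v ∈ l := (List.dropLast_sublist l).subset hv
  obtain ⟨i, hi, rfl⟩ := List.mem_iff_getElem.1 hv'
  exact h ⟨i, mem_botIdxs_iff.2 ⟨hi, hv0⟩⟩

/-- ★★ **The linear chain-to-bridge comparison, finite form** (`T ≥ 1`, `y ≥ 0`): with `S_N := Σ_{l ∈ chainsUpTo T N} x_c^{|l|−1}`,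
`Σ_{n ≤ N} x_c^n Z_{T,n}(y) ≤ S_N + 𝔅_{T,N}(y) + 2 · 𝔅_{T,N}(y) · x_c⁻¹ B_{T,N}(x_c; y) · S_N`.
(No top vertex: weight `x_c^n`; a top but no bottom vertex: bottom-avoiding; otherwise the direct split or its time reversal.)
[cite: DuminilCopinSmirnov2012, §3 ("Z(x) ≤ … ∏ (1 + B_T^x)²" — the quadratic unfolding bound this LINEAR one replaces inside one strip); BeatonBousquetMelouDeGierDuminilCopinGuttmann2014, §3.2–§3.3; lane: NEW] -/
theorem sum_pow_mul_stripZL_le_aux (hT : 1 ≤ T) {y : ℝ} (hy : 0 ≤ y) (N : ℕ) :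
    ∑ n ∈ range (N + 1), hexCriticalFugacity ^ n * stripZL T n y ≤
      (∑ C ∈ chainsUpTo T N, hexCriticalFugacity ^ (C.length - 1)) + botAvoidSum T N y +
        2 * (botAvoidSum T N y * ((hexCriticalFugacity⁻¹ * stripGFy T N (IsBetaDart T) y) *
          ∑ C ∈ chainsUpTo T N, hexCriticalFugacity ^ (C.length - 1))) := by
  classical
  have hx := hexCriticalFugacity_pos_lt_one.1
  set U := chainsUpTo T N with hU
  set S := ∑ C ∈ U, hexCriticalFugacity ^ (C.length - 1) with hS
  set D := ∑ l ∈ caseDSet T N, cwt T y l with hDdef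
  have hD : D ≤ botAvoidSum T N y * ((hexCriticalFugacity⁻¹ * stripGFy T N (IsBetaDart T) y) * S) := sum_caseD_le hT hy N
  rw [← sum_cwt_chainsUpTo, ← hU]
  -- split off the chains without top vertices
  rw [← sum_filter_add_sum_filter_not U (fun l => (topIdxs T l).Nonempty)]
  have h0 : ∑ l ∈ U.filter (fun l => ¬ (topIdxs T l).Nonempty), cwt T y l ≤ S := by
    calc ∑ l ∈ U.filter (fun l => ¬ (topIdxs T l).Nonempty), cwt T y l
        = ∑ l ∈ U.filter (fun l => ¬ (topIdxs T l).Nonempty), hexCriticalFugacity ^ (l.length - 1) :=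
          sum_congr rfl fun l hl => by rw [cwt, topCnt_eq_zero_of_not_nonempty (mem_filter.1 hl).2, pow_zero, mul_one]
      _ ≤ S := sum_le_sum_of_subset_of_nonneg (filter_subset _ _) fun l _ _ => pow_nonneg hx.le _
  -- among the chains with a top vertex, split off those without bottom vertices
  set U₁ := U.filter (fun l => (topIdxs T l).Nonempty) with hU₁
  rw [← sum_filter_add_sum_filter_not U₁ (fun l => (botIdxs l).Nonempty)]
  have h1 : ∑ l ∈ U₁.filter (fun l => ¬ (botIdxs l).Nonempty), cwt T y l ≤ botAvoidSum T N y := by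
    refine sum_le_sum_of_subset_of_nonneg (fun l hl => ?_) fun l _ _ => cwt_nonneg T hy l
    rw [mem_filter, hU₁, mem_filter] at hl
    exact mem_botAvoidN_of_not_nonempty hl.1.1 hl.2
  -- the rest: direct case or reversed case
  set U₂ := U₁.filter (fun l => (botIdxs l).Nonempty) with hU₂
  rw [← sum_filter_add_sum_filter_not U₂ (CaseD T)]
  have h2 : ∑ l ∈ U₂.filter (CaseD T), cwt T y l ≤ D :=
    sum_le_sum_of_subset_of_nonneg (fun l hl => by
      simp only [hU₂, hU₁, mem_filter] at hl
      exact mem_filter.2 ⟨hl.1.1.1, hl.2⟩) fun l _ _ => cwt_nonneg T hy l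
  have h3 : ∑ l ∈ U₂.filter (fun l => ¬ CaseD T l), cwt T y l ≤ D := by
    refine le_trans (sum_le_sum_of_subset_of_nonneg (fun l hl => ?_) fun l _ _ => cwt_nonneg T hy l) (sum_caseR_le T N hy)
    simp only [hU₂, hU₁, mem_filter] at hl
    exact mem_filter.2 ⟨hl.1.1.1, hl.1.1.2, hl.1.2, hl.2⟩
  linarith

end LinLow

/-! ### §7 The linear chain-to-bridge comparison and the lower linear law at the threshold -/

open LinLow

variable {T : ℕ}

/-- ★★ **Chains are bounded by bridges LINEARLY** (`T ≥ 2`): there are constants `K₁` and `K₂ > 0` (depending on `T` only) with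
`Σ_{n ≤ N} x_c^n Z_{T,n}(y) ≤ K₁ + K₂ · B_{T,N}(x_c; y)` for every `N` and every `1 ≤ y ≤ y_T`.  (The tree's `HV.sum_pow_mul_stripZL_le_at`
— the Duminil-Copin–Smirnov cut of a chain into two weak bridges — is QUADRATIC in the bridge bound; the linear form cuts instead at the
FIRST bottom vertex and the LAST top vertex, the two end pieces having finite total weight because a walk off one wall lives in the
strip of width `T − 1` and `1 < y ≤ y_T < y_{T−1}`.)
[cite: DuminilCopinSmirnov2012, §3 (the bridges of S_{T,L}; "Z(x) ≤ … ∏ (1 + B_T^x)²"); BeatonBousquetMelouDeGierDuminilCopinGuttmann2014, Corollary 8 and its proof (arXiv v5 pp. 12–13: radius y_T, "y_{T+1} < y_T"); lane «pcv-sawmu»: NEW (the linear comparison)] -/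
theorem sum_pow_mul_stripZL_le_linear (hT : 2 ≤ T) :
    ∃ K₁ K₂ : ℝ, 0 < K₂ ∧ ∀ y : ℝ, 1 ≤ y → y ≤ stripYT T → ∀ N : ℕ,
      ∑ n ∈ range (N + 1), hexCriticalFugacity ^ n * stripZL T n y ≤ K₁ + K₂ * stripGFy T N (IsBetaDart T) y := by
  have hT1 : 1 ≤ T := by omega
  have hx := hexCriticalFugacity_pos_lt_one.1
  obtain ⟨S, hS0, hS⟩ := exists_sum_pow_length_le hT1
  have hlt : stripYT T < stripYT (T - 1) := by
    have h := stripYT_succ_lt (T := T - 1) (by omega)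
    rwa [Nat.sub_add_cancel hT1] at h
  obtain ⟨C, hC⟩ := exists_botAvoidSum_le hT (one_le_stripYT hT1) hlt
  have hC0 : 0 ≤ C := (botAvoidSum_nonneg T 0 (stripYT_pos hT1).le).trans (hC 0)
  refine ⟨S + C, 2 * (C * (hexCriticalFugacity⁻¹ * S)) + 1, by positivity, fun y hy1 hyT N => ?_⟩
  have hy0 : 0 ≤ y := by linarith
  have hB0 : 0 ≤ stripGFy T N (IsBetaDart T) y := stripGFy_nonneg' T N _ hy0
  have h𝔅 : botAvoidSum T N y ≤ C := (botAvoidSum_mono_y T N hy0 hyT).trans (hC N)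
  have h𝔅0 : 0 ≤ botAvoidSum T N y := botAvoidSum_nonneg T N hy0
  have hSN := hS N
  have hSN0 : 0 ≤ ∑ C ∈ chainsUpTo T N, hexCriticalFugacity ^ (C.length - 1) := sum_nonneg fun _ _ => pow_nonneg hx.le _
  have haux := sum_pow_mul_stripZL_le_aux hT1 hy0 N
  have hprod : botAvoidSum T N y * ((hexCriticalFugacity⁻¹ * stripGFy T N (IsBetaDart T) y) *
      ∑ C ∈ chainsUpTo T N, hexCriticalFugacity ^ (C.length - 1)) ≤
      C * ((hexCriticalFugacity⁻¹ * stripGFy T N (IsBetaDart T) y) * S) := by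
    have hm : 0 ≤ hexCriticalFugacity⁻¹ * stripGFy T N (IsBetaDart T) y := mul_nonneg (inv_nonneg.2 hx.le) hB0
    exact mul_le_mul h𝔅 (mul_le_mul_of_nonneg_left hSN hm) (mul_nonneg hm hSN0) hC0
  have e : C * ((hexCriticalFugacity⁻¹ * stripGFy T N (IsBetaDart T) y) * S) =
      C * (hexCriticalFugacity⁻¹ * S) * stripGFy T N (IsBetaDart T) y := by ring
  rw [e] at hprod
  nlinarith

/-- ★★★ **THE LOWER LINEAR LAW AT THE THRESHOLD, every width `T ≥ 2`**: there are `c > 0` and `C` with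
`c · (N + 1) − C ≤ B_{T,N}(x_c; y_T)` for every `N` — Fekete's floor `N + 1 ≤ max(1, y_T⁻¹) Σ_{n ≤ N} x_c^n Z_{T,n}(y_T)`
(`ν_T(y_T) = x_c⁻¹`) against the linear comparison.  No transfer matrix, no rationality.
[cite: BeatonBousquetMelouDeGierDuminilCopinGuttmann2014, Corollary 8 (arXiv v5 p. 12: "The series … B_T(x_c, y) … have radius of convergence y_T"; rational by the proof of Proposition 7, p. 12 — no rate in L printed); lane «pcv-sawmu»: NEW quantitative law (the tree had √(N+1), `HV.exists_sqrt_le_stripGFy_beta_stripYT`)] -/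
theorem exists_linear_le_stripGFy_beta_stripYT_of_two_le (hT : 2 ≤ T) :
    ∃ c : ℝ, 0 < c ∧ ∃ C : ℝ, ∀ N : ℕ, c * ((N : ℝ) + 1) - C ≤ stripGFy T N (IsBetaDart T) (stripYT T) := by
  have hT1 : 1 ≤ T := by omega
  obtain ⟨K₁, K₂, hK₂, hK⟩ := sum_pow_mul_stripZL_le_linear hT
  have hy := stripYT_pos hT1
  have hYK : 0 < HexBW.yK (stripYT T) := lt_of_lt_of_le one_pos (HexBW.one_le_yK _)
  refine ⟨1 / (HexBW.yK (stripYT T) * K₂), by positivity, K₁ / K₂, fun N => ?_⟩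
  have h1 := succ_le_mul_sum_pow_mul_stripZL hT1 hy (by rw [stripNu_stripYT hT1]) N
  have h2 := hK (stripYT T) (one_le_stripYT hT1) le_rfl N
  -- (N+1) ≤ yK · (K₁ + K₂ B)
  have h3 : (N : ℝ) + 1 ≤ HexBW.yK (stripYT T) * (K₁ + K₂ * stripGFy T N (IsBetaDart T) (stripYT T)) :=
    h1.trans (mul_le_mul_of_nonneg_left h2 hYK.le)
  have h4 : ((N : ℝ) + 1) / (HexBW.yK (stripYT T) * K₂) ≤ K₁ / K₂ + stripGFy T N (IsBetaDart T) (stripYT T) := by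
    rw [div_le_iff₀ (by positivity)]
    have e : (K₁ / K₂ + stripGFy T N (IsBetaDart T) (stripYT T)) * (HexBW.yK (stripYT T) * K₂) =
        HexBW.yK (stripYT T) * (K₁ / K₂ * K₂ + K₂ * stripGFy T N (IsBetaDart T) (stripYT T)) := by ring
    rw [e, div_mul_cancel₀ K₁ hK₂.ne']
    exact h3
  rw [one_div_mul_eq_div]
  linarith

/-- ★★★ **THE LOWER LINEAR LAW AT THE THRESHOLD, every width `T ≥ 1`**: there are `c > 0` and `C` (depending on `T`) with
`c · (N + 1) − C ≤ B_{T,N}(x_c; y_T)` for every `N`.  (`T = 1`: `B_{1,N}(x_c; y_1) = 2(N+1)` exactly, `HexSAWStripSurfaceWidthOneThreshold`;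
`T ≥ 2`: `exists_linear_le_stripGFy_beta_stripYT_of_two_le`.)  With the lane's linear UPPER law `B_{T,L}(x_c; y_T) ≤ C'(L+1)` (a-p2 g16,
`HexSAWStripBridgeRenewal`, filing queued) this is `B_{T,L}(x_c; y_T) ≍ L` for every width.
[cite: BeatonBousquetMelouDeGierDuminilCopinGuttmann2014, Corollary 8 (arXiv v5 p. 12) and proof of Proposition 7 (p. 12: "a rational function of x and y"); lane «pcv-sawmu»: NEW — the lane's conjectured linear divergence law (lower half), unconditional and automaton-free] -/
theorem exists_linear_le_stripGFy_beta_stripYT (hT : 1 ≤ T) :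
    ∃ c : ℝ, 0 < c ∧ ∃ C : ℝ, ∀ N : ℕ, c * ((N : ℝ) + 1) - C ≤ stripGFy T N (IsBetaDart T) (stripYT T) := by
  rcases (show T = 1 ∨ 2 ≤ T by omega) with rfl | h2
  · refine ⟨2, by norm_num, 0, fun N => ?_⟩
    rw [stripGFy_beta_one_stripYT_one N]
    linarith
  · exact exists_linear_le_stripGFy_beta_stripYT_of_two_le h2

/-- The same law in "eventually" form: `∃ c > 0, ∀ᶠ N, c · N ≤ B_{T,N}(x_c; y_T)` (`T ≥ 1`).
[cite: BeatonBousquetMelouDeGierDuminilCopinGuttmann2014, Corollary 8 (arXiv v5 p. 12); lane «pcv-sawmu»] -/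
theorem eventually_linear_le_stripGFy_beta_stripYT (hT : 1 ≤ T) :
    ∃ c : ℝ, 0 < c ∧ ∀ᶠ N : ℕ in atTop, c * (N : ℝ) ≤ stripGFy T N (IsBetaDart T) (stripYT T) := by
  obtain ⟨c, hc, C, hC⟩ := exists_linear_le_stripGFy_beta_stripYT hT
  refine ⟨c / 2, by positivity, ?_⟩
  have hev : ∀ᶠ N : ℕ in atTop, C ≤ c / 2 * (N : ℝ) := by
    have ht : Tendsto (fun N : ℕ => c / 2 * (N : ℝ)) atTop atTop :=
      tendsto_natCast_atTop_atTop.const_mul_atTop (by positivity)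
    exact ht.eventually_ge_atTop C
  filter_upwards [hev] with N hN
  have := hC N
  nlinarith

/-- ★★ **The arches diverge linearly at the threshold too**: `c' · (N + 1) − C' ≤ A_{T,N+1}(x_c; y_T)` for every `N` (`T ≥ 1`) — identity
(16) at `y = y_T > y*` reads `cos(3π/8) A_{T,N} + cos(π/4) E_{T,N} = 1 + |β(y_T)| B_{T,N}`, and `E_{T,N} ≤ x_c^{1−2T} A_{T,N+1}`, `A_{T,N} ≤ A_{T,N+1}`.
[cite: BeatonBousquetMelouDeGierDuminilCopinGuttmann2014, §4.1 eq. (16) (arXiv v5 p. 13) and Corollary 8 (p. 12); lane «pcv-sawmu»: NEW quantitative law] -/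
theorem exists_linear_le_stripGFy_alpha_stripYT (hT : 1 ≤ T) :
    ∃ c : ℝ, 0 < c ∧ ∃ C : ℝ, ∀ N : ℕ, c * ((N : ℝ) + 1) - C ≤ stripGFy T (N + 1) IsAlphaDart (stripYT T) := by
  obtain ⟨c, hc, C, hC⟩ := exists_linear_le_stripGFy_beta_stripYT hT
  have hy := stripYT_pos hT
  have hβ : 0 < -betaY (stripYT T) := by linarith [betaY_neg_of_yStar_lt (yStar_lt_stripYT hT)]
  have hcα := cos_three_pi_div_eight_pos
  have hcε := cos_pi_div_four_pos'
  have hxi : 0 < (hexCriticalFugacity ^ (2 * T - 1))⁻¹ := inv_pos.2 (pow_pos hexCriticalFugacity_pos_lt_one.1 _)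
  set D := Real.cos (3 * Real.pi / 8) + Real.cos (Real.pi / 4) * (hexCriticalFugacity ^ (2 * T - 1))⁻¹ with hD
  have hD0 : 0 < D := by rw [hD]; positivity
  refine ⟨-betaY (stripYT T) * c / D, by positivity, -betaY (stripYT T) * C / D, fun N => ?_⟩
  have hid := stripIdentityY_holds T N (stripYT T) hT hy
  have hE := stripGFy_eps_le_mul_alpha_succ hT N hy.le
  have hA := stripGFy_alpha_mono_L (T := T) (Nat.le_succ N) hy.le
  have hB := hC N
  have h1 : Real.cos (3 * Real.pi / 8) * stripGFy T N IsAlphaDart (stripYT T) +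
      Real.cos (Real.pi / 4) * stripGFy T N (IsEpsDart N) (stripYT T) ≤ D * stripGFy T (N + 1) IsAlphaDart (stripYT T) := by
    rw [hD, add_mul, mul_assoc]
    exact add_le_add (mul_le_mul_of_nonneg_left hA hcα.le) (mul_le_mul_of_nonneg_left hE hcε.le)
  have h2 : -betaY (stripYT T) * (c * ((N : ℝ) + 1) - C) ≤ D * stripGFy T (N + 1) IsAlphaDart (stripYT T) := by
    have := mul_le_mul_of_nonneg_left hB hβ.le
    nlinarith
  have e : -betaY (stripYT T) * c / D * ((N : ℝ) + 1) - -betaY (stripYT T) * C / D =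
      -betaY (stripYT T) * (c * ((N : ℝ) + 1) - C) / D := by ring
  rw [e, div_le_iff₀ hD0]
  linarith

/-- The partial sums of the chain series at the threshold are comparable to the bridge sums, and both grow at least linearly:
`N + 1 ≤ max(1, y_T⁻¹) · (K₁ + K₂ · B_{T,N}(x_c; y_T))` (`T ≥ 2`) — Fekete's floor in the form used above, recorded for reuse.
[cite: BeatonBousquetMelouDeGierDuminilCopinGuttmann2014, Proposition 6 and Corollary 8 (arXiv v5 pp. 10–13); lane «pcv-sawmu»] -/
theorem succ_le_yK_mul_linear_stripGFy_beta_stripYT (hT : 2 ≤ T) :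
    ∃ K₁ K₂ : ℝ, 0 < K₂ ∧ ∀ N : ℕ,
      (N : ℝ) + 1 ≤ HexBW.yK (stripYT T) * (K₁ + K₂ * stripGFy T N (IsBetaDart T) (stripYT T)) := by
  have hT1 : 1 ≤ T := by omega
  obtain ⟨K₁, K₂, hK₂, hK⟩ := sum_pow_mul_stripZL_le_linear hT
  have hYK : 0 < HexBW.yK (stripYT T) := lt_of_lt_of_le one_pos (HexBW.one_le_yK _)
  refine ⟨K₁, K₂, hK₂, fun N => ?_⟩
  exact (succ_le_mul_sum_pow_mul_stripZL hT1 (stripYT_pos hT1) (by rw [stripNu_stripYT hT1]) N).trans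
    (mul_le_mul_of_nonneg_left (hK (stripYT T) (one_le_stripYT hT1) le_rfl N) hYK.le)

/-! ### §8 The coefficient form: `Σ_{m ≤ M} β_{T,m} y_T^m ≥ s·M − C` for every `T ≥ 1`, unconditionally -/

namespace LinLow

/-- `|V(S_{T,L})| ≤ 4(T+1)L + 2(T+1)²` (the box sits inside `[-L-T, L] × [0, T] × {0,1}`).
[cite: DuminilCopinSmirnov2012, §3 (the domain S_{T,L}); lane plumbing] -/
theorem card_stripV_le_affine (T L : ℕ) : (stripV T L).card ≤ 4 * (T + 1) * L + 2 * (T + 1) ^ 2 := by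
  unfold stripV
  refine (card_filter_le _ _).trans ?_
  rw [card_product, card_product, Int.card_Icc, Int.card_Icc, card_univ, Fintype.card_bool]
  have h1 : ((L : ℤ) + 1 - (-(L : ℤ) - T)).toNat = 2 * L + T + 1 := by omega
  have h2 : ((T : ℤ) + 1 - 0).toNat = T + 1 := by omega
  rw [h1, h2]
  nlinarith

/-- A walk of `S_{T,L}` has at most `|V(S_{T,L})|` surface contacts. [cite: BeatonBousquetMelouDeGierDuminilCopinGuttmann2014, §2 (arXiv v5 p. 4: c(γ), the number of contacts); lane plumbing] -/
theorem surfContacts_le_card_stripV {L : ℕ} {P : List HV} (hP : P ∈ midWalks (stripV T L)) : surfContacts T P ≤ (stripV T L).card := by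
  rw [mem_midWalks_iff] at hP
  exact (List.length_filter_le _ _).trans (hP.length_inner.le.trans hP.mwLen_le_card)

/-- `β_{T,L,m} = 0` for `m > |V(S_{T,L})|`. [cite: BeatonBousquetMelouDeGierDuminilCopinGuttmann2014, §3.2 (arXiv v5 p. 12: B_T(x;y) as a series in y); lane plumbing] -/
theorem stripBcoeffY_eq_zero_of_lt {L m : ℕ} (hm : (stripV T L).card < m) : stripBcoeffY T L m = 0 := by
  unfold stripBcoeffY
  refine sum_eq_zero fun P hP => ?_
  rw [mem_filter, mem_filter] at hP
  have := surfContacts_le_card_stripV hP.1.1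
  omega

/-- `B_{T,L}(x_c; y) ≤ Σ_{m ≤ |V(S_{T,L})|} β_{T,m} y^m` (`T ≥ 1`, `y ≥ 0`): the box polynomial has degree at most `|V(S_{T,L})|` and its
coefficients increase to `β_{T,m}`. [cite: BeatonBousquetMelouDeGierDuminilCopinGuttmann2014, §4.2 (arXiv v5 p. 14: the finite-box series increase with L) and Corollary 8 (p. 12); lane plumbing] -/
theorem stripGFy_beta_le_partialSum_card (hT : 1 ≤ T) {y : ℝ} (hy : 0 ≤ y) (L : ℕ) :
    stripGFy T L (IsBetaDart T) y ≤ ∑ m ∈ range ((stripV T L).card + 1), stripBcoeff T m * y ^ m := by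
  have e : stripGFy T L (IsBetaDart T) y = ∑ m ∈ range ((stripV T L).card + 1), stripBcoeffY T L m * y ^ m := by
    refine (hasSum_stripBcoeffY T L y).unique (hasSum_sum_of_ne_finset_zero fun m hm => ?_)
    rw [mem_range, not_lt] at hm
    rw [stripBcoeffY_eq_zero_of_lt (by omega), zero_mul]
  rw [e]
  exact sum_le_sum fun m _ => mul_le_mul_of_nonneg_right (stripBcoeffY_le_stripBcoeff hT L m) (pow_nonneg hy m)

end LinLow

/-- ★★★ **THE LOWER LINEAR LAW, COEFFICIENT FORM, every `T ≥ 1`, unconditionally**: there are `s > 0` and `C` with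
`s · M − C ≤ Σ_{m ≤ M} β_{T,m} y_T^m` for every `M` (`β_{T,m} = HV.stripBcoeff T m`, the coefficients of `B_T(x_c; ·)`).  From the box law
`exists_linear_le_stripGFy_beta_stripYT` with `L = ⌊(M − 2(T+1)²)/(4(T+1))⌋`, since `B_{T,L}(x_c; y_T) ≤ Σ_{m ≤ |V(S_{T,L})|} β_{T,m} y_T^m`
and `|V(S_{T,L})| ≤ 4(T+1)L + 2(T+1)²`.  (HOME prior art: a-idea-1's cars 29/32 derive this law FROM the boundedness of `β_{T,m} y_T^m`, i.e.
from the lane's first-order bound (P); here it needs neither.)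
[cite: BeatonBousquetMelouDeGierDuminilCopinGuttmann2014, Corollary 8 (arXiv v5 p. 12: "The series (in y) … B_T(x_c, y) … have radius of convergence y_T"); lane «pcv-sawmu»: NEW quantitative law] -/
theorem partialSum_stripBcoeff_stripYT_ge_linear (hT : 1 ≤ T) :
    ∃ s : ℝ, 0 < s ∧ ∃ C : ℝ, ∀ M : ℕ, s * (M : ℝ) - C ≤ ∑ m ∈ range (M + 1), stripBcoeff T m * stripYT T ^ m := by
  obtain ⟨c, hc, C₀, hC₀⟩ := exists_linear_le_stripGFy_beta_stripYT hT
  have hy := (stripYT_pos hT).le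
  set a : ℕ := 4 * (T + 1) with ha
  set b : ℕ := 2 * (T + 1) ^ 2 with hb
  have ha0 : 0 < a := by rw [ha]; positivity
  have haR : (0 : ℝ) < a := by exact_mod_cast ha0
  have hterm : ∀ m, 0 ≤ stripBcoeff T m * stripYT T ^ m := fun m => mul_nonneg (stripBcoeff_nonneg hT m) (pow_nonneg hy m)
  refine ⟨c / a, by positivity, c / a * b + max C₀ 0 + c, fun M => ?_⟩
  have hmax : C₀ ≤ max C₀ 0 := le_max_left _ _
  have hmax0 : 0 ≤ max C₀ 0 := le_max_right _ _
  by_cases hM : b ≤ M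
  · -- L = ⌊(M − b)/a⌋ : the box S_{T,L} has at most M vertices
    set L : ℕ := (M - b) / a with hL
    have hcard : (stripV T L).card ≤ M := by
      have h1 := LinLow.card_stripV_le_affine T L
      have h2 : a * L ≤ M - b := Nat.mul_div_le (M - b) a
      rw [← ha, ← hb] at h1
      omega
    have hLM : ((M : ℝ) - b) / a ≤ (L : ℝ) + 1 := by
      have h3 : M - b < a * (L + 1) := by
        rw [hL]; exact Nat.lt_mul_div_succ (M - b) ha0
      have h4 : ((M - b : ℕ) : ℝ) < (a : ℝ) * ((L : ℝ) + 1) := by exact_mod_cast h3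
      rw [Nat.cast_sub hM] at h4
      rw [div_le_iff₀ haR]
      linarith
    calc c / a * (M : ℝ) - (c / a * b + max C₀ 0 + c)
        = c * (((M : ℝ) - b) / a) - max C₀ 0 - c := by field_simp; ring
      _ ≤ c * ((L : ℝ) + 1) - C₀ - c := by nlinarith [mul_le_mul_of_nonneg_left hLM hc.le]
      _ ≤ stripGFy T L (IsBetaDart T) (stripYT T) := by linarith [hC₀ L]
      _ ≤ ∑ m ∈ range ((stripV T L).card + 1), stripBcoeff T m * stripYT T ^ m :=
          LinLow.stripGFy_beta_le_partialSum_card hT hy L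
      _ ≤ ∑ m ∈ range (M + 1), stripBcoeff T m * stripYT T ^ m :=
          sum_le_sum_of_subset_of_nonneg (range_subset_range.2 (by omega)) fun m _ _ => hterm m
  · -- small M: the bound is negative
    have hMb : (M : ℝ) < b := by exact_mod_cast (not_le.1 hM)
    have h0 : 0 ≤ ∑ m ∈ range (M + 1), stripBcoeff T m * stripYT T ^ m := sum_nonneg fun m _ => hterm m
    have h1 : c / a * (M : ℝ) ≤ c / a * b := mul_le_mul_of_nonneg_left hMb.le (by positivity)
    linarith

end Literature.Probability.RandomPlanarGeometry.SAW.HV
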